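import Literature.MathematicalPhysics.QuantumFieldTheory.Balaban1983to89.Node00.ROperationOfRecordEss
import Literature.MathematicalPhysics.QuantumFieldTheory.Balaban1983to89.Node00.Record12MeasurabilityAnySelector

/-!
# NODE 00 — DEFINER ₇ (R-side), FILE 17: the (0.3) ∕ (0.4) chain of the ℝ-operation under INTEGRABLE pieces — the fourth proviso form
# `ProvisoForm.int` (pieces integrable, `≥ 0` a.e., support clause a.e.; NO uniform bound), (0.4) PROVED under it, the support clause
# AUTOMATIC at the identity selector, and ROW P6 (`Provisos₁₀.rstep`) IN THAT FORM from (H-U) and the ζ-laws alone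

T. Bałaban, *Large field renormalization. I*, Commun. Math. Phys. **122** (1989) 175–202 [Balaban1989LargeFieldI] = [IV], (0.2)–(0.4) p. 176,
(1.102) p. 201; *Convergent renormalization expansions …*, Commun. Math. Phys. **119** (1988) 243–285 [Balaban1988Convergent] = [III], (2.17)–(2.18)
p. 257, (3.24)–(3.25) p. 270.  Cell `pub-ymgap`, seat `pub-ymgap-node00-def-R` g7 (K0′ = `Record12Inhabited`, row P6 of the K0′ component ledger).
FILE 9′ = `Node00/ROperationOfRecordForm` (proviso FORMS `.std` ∕ `.supp`), FILE 10 = `Node00/RStepProvisosOfRecord`, FILE 12 = `Node00/ROperationOfRecordEss`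
(`.ess`); b01 = `B15BasicStep`, n10-b = `B15FibreLemmaSupp`; K0c = `Node00/Record12Measurability` (FILE 1) ∕ `…AnySelector` (FILE 2).  Token `Int` (this
file) = the INTEGRABLE form of the (0.3) provisos.

CITATION HEADER (verbatim, [IV] p. 176): (0.3) *«(ℝρ)(V) = Σ_Z ρ(Z″, V) ∫dV⌈_{Z′}ρ(Z, V) ∕ ∫dV⌈_{Z′}ρ(Z″, V)»*; *«the densities are positive, and the
integration domains in the integrals above are nonempty, hence the denominators are positive»*; (0.4) *«It satisfies the basic normalization property
∫dV(𝐑ρ)(V) = ∫dVρ(V).»*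

WHY.  Row P6 of K0′ is the field `rstep` of def-T's `Stage9Params.Provisos₁₀` (`Record10` :281): the R-step datum of the tower of record at every level
`k + 1` satisfies n10-b's `RepData.ProvisosSupp` — FILE 10 `provisosSupp_towerRepOfRecord_iff`: (c1) pieces `t_s = χ_{k+1}(s)·(𝐓ρ_k)(s)` measurable,
(c2) `t_s ≥ 0`, (c3) `∃ C, ∀ s V, t_s(V) ≤ C`, (c4) the support clause AT EVERY `V`.  (c1), (c2) are kernel facts of the objects of record under (H-U) and
the ζ-laws (K0c FILE 1 ∕ FILE 2, n23-b's sign lemmas).  (c3) and (c4) are OVER-STRENGTH OF THE FORM, not of print: the 𝐓-slots of record read the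
`rnDeriv` representative of the marginal density of the averaging transport POINTWISE (n23-b's census (H-h); K0c: «(H-h) survives only in `rstep`
conjunct 3»), so no pointwise ∕ essential uniform bound is a theorem of the tree — only INTEGRABILITY is (K0c `integrable_tstepOfRecord`); and at the
selector of record so far (the identity `Z″ := Z`) the support clause *«∫dV⌈_{Z′} t_s = 0 at V ⇒ t_s(V) = 0»* holds for ALMOST EVERY `V` (a non-negative
function with vanishing fibre integral vanishes a.e. on the fibre), never at every `V`.  b01 ∕ n10-b ∕ FILE 12 use the bound ONLY to make every fibre
integral finite; for an integrable piece the fibre integrals are finite ALMOST everywhere, and the (0.4) identity survives because total integrals are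
integrals of fibre integrals (b01 `lintegral_lmarginal_eq`).  THIS FILE types the form the objects of record DO satisfy and proves the same two
certificates for it:

* §1 THE CHAIN UNDER INTEGRABILITY (generic, then over `Setup`): **`lmarginal_realRatio_term_ae_eq`** — for measurable `den` with `∫⌈_s den`,
  `∫⌈_s num` finite a.e. and `∫⌈_s den = 0 ⇒ ∫⌈_s num = 0` a.e., `∫⌈_s [den · ofReal(toReal ∫⌈_s num ∕ toReal ∫⌈_s den)] = ∫⌈_s num` ALMOST EVERYWHERE
  (b01's `lmarginal_ratio_term` ∕ n10-b's `_supp` with every proviso a.e.); **`lintegral_realRatio_term_eq`** — hence equal total integrals;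
  over `Setup`: `measurable_normTerm`, `lintegral_lmarginal_ofReal_eq`, `lmarginal_ofReal_ae_ne_top` (integrable ⇒ fibre integrals a.e. finite),
  **`lmarginal_supp_ae_of_suppAE`** (the a.e. support clause on the PIECE gives the a.e. clause on its FIBRE INTEGRAL — FILE 12's `lmarginal_congr_ae`
  on a fibre-constant cut-off), **`lintegral_ofReal_normTerm_eq_int`**, **`integral_normTerm_eq_int`** ((1.102) for one component: `new, old ≥ 0`
  measurable and INTEGRABLE, support clause a.e. — NO bound), `exists_measurable_nonneg_modification`, **`integral_ropReal_eq_int`** ((0.4) over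
  `Setup`: pieces integrable, `≥ 0` a.e., support clause a.e.), **`integrable_ropReal_int`** (no support clause; termwise K0c FILE 2's
  `integrable_normTerm_of_integrable`, BY NAME), **`suppClause_self_ae`**: for an integrable `f ≥ 0` a.e., `∫dV⌈_{Z′} f = 0 at V ⇒ f(V) = 0` for
  `dV`-ALMOST EVERY `V` — THE SUPPORT CLAUSE IS AUTOMATIC AT `Z″ := Z` — and `ae_eq_zero_of_self_or_fibreIntegral_eq_zero`: a DEAD piece (at every `V`,
  `f(V) = 0` or `∫dV⌈_{Z′} f = 0 at V`) is `0` a.e., so its support conjunct is trivial WHATEVER `Z″` is.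
* §2 THE DATUM: **`RepData.ProvisosInt`** — pieces `Integrable`, `0 ≤ ρ(Z,·)` a.e., support clause a.e.; `provisosInt_of_provisosEss` ∕ `_of_provisosSupp` ∕
  `_of_provisos` (the fourth form is the WEAKEST of the four), **`integral_rop_eq_of_provisosInt`** ((0.4) FOR THE DATUM), **`integrable_rop_of_provisosInt`**,
  `rop_nonneg_ae_of_provisosInt`, `integrable_total_of_provisosInt`, **`provisosInt_of_pp_eq_self`**: at a datum whose selector is the identity the
  support conjunct DROPS OUT (integrable non-negative pieces suffice), and **`provisosInt_of_pp_fixed_or_null`**: the same at a datum whose selector moves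
  only DEAD pieces.
* §3 THE FORM AND THE PINS (TS-8 instance-closed, as FILE 9′ ∕ FILE 12): **`ProvisoForm.int`** (fourth form beside `.std` ∕ `.supp` ∕ `.ess`), monotonicity
  `int_of_ess` ∕ `int_of_supp` ∕ `int_of_std` ∕ `admissibleBy_int_of_ess` ∕ `_of_supp`, `…_instIrrel`, `ropTotalBy_int_nonneg_ae`; `ProvisoFormOfRecord.int`,
  **`ROp03IntOfRecord`** (v1.4 = `R` of record over the integrable form — OFFERED, not swapped: the ₇ plug of record stays v1.2 `ROp03SuppOfRecord`
  unless a successor record adopts v1.4; v1.4 is admissible wherever v1.2 ∕ v1.3 are) with `preservesIntegral_ROp03IntOfRecord` ∕ `integrable_ROp03IntOfRecord`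
  and the branch lemmas.
* §4 GENERIC (2.18) FACES (FILE 10 §1 twins): `provisosInt_repDataOfSel_iff` (`Iff.rfl`), `provisosInt_repDataOfSel_of_factors`,
  **`provisosInt_repDataOfSel_of_sel_id`** (identity selector: χ a.e.-strongly measurable with `0 ≤ χ ≤ 1`, slots integrable and `≥ 0` a.e. — nothing else)
  and **`provisosInt_repDataOfSel_of_sel_fixed_or_null`** (any selector moving only DEAD summands — e.g. identity on the LIVE sequences, the rest
  collapsed onto live ones, the shape director's LINE №114 (α) re-pins the K0′ witness to).
* §5 TOWER-OF-RECORD FACES (FILE 10 §2 ∕ FILE 12 §7 twins, consumer's instance): **`provisosInt_towerRepOfRecord_iff`** (`Iff.rfl`), `…_of_provisosSupp` ∕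
  `…_of_provisosEss`, `…_of_slots`, **`provisosInt_towerRepOfRecord_of_sel_id`**, **`…_of_sel_fixed_or_null`**, `…_of_slot_eq_zero` (K0 junk inhabitant),
  **`integral_densityOfSlice_rstepSlotOfRecord_of_provisosInt`** ((0.4) at a slot family), `integrable_…`, and the plug-at-the-tower faces
  `ROp03IntOfRecord_repOfDataAE_of_ae` ∕ `_repOfRecordAE_of_ae` ∕ `_repOfRecordAE_eq_densityOfSlice` ∕ `integral_ROp03IntOfRecord_repOfRecordAE`.
* §6 ROW P6 IN THE INTEGRABLE FORM at a Stage-9 parameter: `Stage9Params.slotsTOfRecord_nonneg_of_zeta_nonneg`, **`Stage9Params.integrable_slotsTOfRecord_succ_of_localBg`**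
  (the 𝐓-slots of record are INTEGRABLE at every positive level under (H-U) ∧ (H-ζ) ∧ |ζ| ≤ 1 ∧ 0 ≤ ζ, any selector — K0c FILE 1 ∕ 2), **`Stage9Params.RStepInt`** —
  the text of `Provisos₁₀.rstep` with `.ProvisosSupp` replaced by `.ProvisosInt` (the field a successor record keys if it adopts the form; this file restates ∕
  edits NO record), `rstepInt_of_rstep` ∕ `rstepInt_of_provisos₁₀` (the keyed row implies it: re-keying loses nothing), **`Stage9Params.rstepInt_of_localBg_of_sel`**
  — AT A `θ` WHOSE SELECTOR MOVES ONLY DEAD SEQUENCES (fixed on the rest; the identity, and the live-sequence selector of LINE №114 (α), are such),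
  `θ.RStepInt` from (H-U) `LocalBgMeasurable`, (H-ζ) `ZetaMeasurable θ.ζ`, the ζ-size law `IsZetaAbsLeOne` and the sign law `0 ≤ ζ` ALONE (K0c measurability +
  integrability, n23-b's `slotsTOfRecord_nonneg`, §1's `suppClause_self_ae` ∕ dead pieces) — no (H-h), no (H-supp) (compare n23-b's
  `provisos₁₀_stage9DeltaOfRecord_of_regularity`, which needs both for the keyed form); **`Stage9Params.rstepInt_of_localBg`** (identity selector, corollary);
  and `Stage9Params.rstepInt_of_localBg_anySel` — at ANY selector, the same modulo the a.e. support conjunct DISPLAYED (at a general `Z ↦ Z″` it is print's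
  «integration domains nonempty», a statement about the carriers, not a measure-theoretic identity).

## HONEST FRAMING — what this is NOT

* Kernel lemmas under WEAKER hypotheses, displayed `def`s and an OFFERED plug v1.4; nothing of Bałaban's asserted (no proviso, no (1.1)–(1.80) estimate,
  no shape law); NO record is restated or edited here, `Provisos₁₀.rstep` ∕ `Provisos₁₂.base` stay keyed as they are (whether a successor record re-keys
  row P6 to `.ProvisosInt` is the plan owner's ∕ def-T's call); no field of `Provisos₁₂` is inhabited at `N ≥ 2`; K0′ is NOT discharged; (H-U) stays a
  DISPLAYED hypothesis; no node count moves (typed 28∕28 · discharged 5∕28).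
* One finite four-torus programme at fixed `ε = L^{−K}` — NOT the continuum limit on ℝ⁴, NOT infinite volume, NOT OS, NOT a mass gap, NOT the Clay
  problem.  No `sorry` ∕ `axiom` ∕ `opaque` ∕ `instance` ∕ `notation`.
-/

open scoped BigOperators ENNReal
open _root_.MeasureTheory Function

noncomputable section

/-! ## §1  THE (0.3) ∕ (0.4) CHAIN UNDER INTEGRABILITY -/

namespace Literature.MathematicalPhysics.QuantumFieldTheory.Balaban1983to89.B15.BasicStep

/-! ### Generic product of probability spaces: the ratio identity with every proviso almost everywhere -/

section FibreAE

variable {ι : Type*} [DecidableEq ι] [Fintype ι] {X : ι → Type*} [∀ i, MeasurableSpace (X i)]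
  (μ : ∀ i, Measure (X i))

/-- **THE RATIO IDENTITY behind (0.3) ∕ (0.4), ALMOST-EVERYWHERE FORM** (b01's `lmarginal_ratio_term`, n10-b's `lmarginal_ratio_term_supp` with EVERY
proviso weakened to `Measure.pi μ`-a.e.): for a measurable `den` whose fibre integral `∫⌈_s den` is finite a.e., a `num` whose fibre integral is finite
a.e., and the support clause *«∫⌈_s den = 0 ⇒ ∫⌈_s num = 0»* a.e., the term `den · ofReal(toReal ∫⌈_s num ∕ toReal ∫⌈_s den)` has fibre integral
`∫⌈_s num` ALMOST EVERYWHERE (the real ratio is a function of the complementary variables and pulls out; on the good fibres `ofReal(a∕b)·b = a`).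
[cite: Balaban1989LargeFieldI, (0.3)–(0.4) p.176] -/
theorem lmarginal_realRatio_term_ae_eq (s : Finset ι) {num den : (∀ i, X i) → ℝ≥0∞} (hden : Measurable den)
    (hden_top : ∀ᵐ x ∂Measure.pi μ, (∫⋯∫⁻_s, den ∂μ) x ≠ ∞) (hnum_top : ∀ᵐ x ∂Measure.pi μ, (∫⋯∫⁻_s, num ∂μ) x ≠ ∞)
    (hsupp : ∀ᵐ x ∂Measure.pi μ, (∫⋯∫⁻_s, den ∂μ) x = 0 → (∫⋯∫⁻_s, num ∂μ) x = 0) :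
    ∫⋯∫⁻_s, (fun x => den x * ENNReal.ofReal (((∫⋯∫⁻_s, num ∂μ) x).toReal / ((∫⋯∫⁻_s, den ∂μ) x).toReal)) ∂μ
      =ᵐ[Measure.pi μ] ∫⋯∫⁻_s, num ∂μ := by
  have hratio : IndepOf s (fun x => ENNReal.ofReal (((∫⋯∫⁻_s, num ∂μ) x).toReal / ((∫⋯∫⁻_s, den ∂μ) x).toReal)) := by
    intro x y
    simp only [indepOf_lmarginal μ s num x y, indepOf_lmarginal μ s den x y]
  have hrw : (fun x => den x * ENNReal.ofReal (((∫⋯∫⁻_s, num ∂μ) x).toReal / ((∫⋯∫⁻_s, den ∂μ) x).toReal))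
      = (fun x => ENNReal.ofReal (((∫⋯∫⁻_s, num ∂μ) x).toReal / ((∫⋯∫⁻_s, den ∂μ) x).toReal)) * den := by
    ext x; simp [mul_comm]
  rw [hrw, lmarginal_mul_of_indepOf s hratio hden]
  filter_upwards [hden_top, hnum_top, hsupp] with x h1 h2 h3
  simp only [Pi.mul_apply]
  by_cases h0 : (∫⋯∫⁻_s, den ∂μ) x = 0
  · rw [h0, mul_zero, h3 h0]
  · rw [ENNReal.ofReal_div_of_pos (ENNReal.toReal_pos h0 h1), ENNReal.ofReal_toReal h2, ENNReal.ofReal_toReal h1,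
      ENNReal.div_mul_cancel h0 h1]

/-- **HENCE EQUAL TOTAL INTEGRALS** over probability fibres: `∫ den · ofReal(toReal ∫⌈_s num ∕ toReal ∫⌈_s den) = ∫ num` for `Measure.pi μ` (a total integral is the
integral of the fibre integral, b01 `lintegral_lmarginal_eq`, and the fibre integrals agree a.e.). [cite: Balaban1989LargeFieldI, (0.4) p.176; Balaban1989LargeFieldI, (1.102) p.201] -/
theorem lintegral_realRatio_term_eq [∀ i, IsProbabilityMeasure (μ i)] (s : Finset ι) {num den : (∀ i, X i) → ℝ≥0∞}
    (hnum : Measurable num) (hden : Measurable den)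
    (hden_top : ∀ᵐ x ∂Measure.pi μ, (∫⋯∫⁻_s, den ∂μ) x ≠ ∞) (hnum_top : ∀ᵐ x ∂Measure.pi μ, (∫⋯∫⁻_s, num ∂μ) x ≠ ∞)
    (hsupp : ∀ᵐ x ∂Measure.pi μ, (∫⋯∫⁻_s, den ∂μ) x = 0 → (∫⋯∫⁻_s, num ∂μ) x = 0) :
    ∫⁻ x, den x * ENNReal.ofReal (((∫⋯∫⁻_s, num ∂μ) x).toReal / ((∫⋯∫⁻_s, den ∂μ) x).toReal) ∂Measure.pi μ
      = ∫⁻ x, num x ∂Measure.pi μ := by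
  have hm : Measurable (fun x => den x * ENNReal.ofReal (((∫⋯∫⁻_s, num ∂μ) x).toReal / ((∫⋯∫⁻_s, den ∂μ) x).toReal)) :=
    hden.mul (ENNReal.measurable_ofReal.comp ((hnum.lmarginal μ).ennreal_toReal.div (hden.lmarginal μ).ennreal_toReal))
  rw [← lintegral_lmarginal_eq μ s hm, ← lintegral_lmarginal_eq μ s hnum]
  exact lintegral_congr_ae (lmarginal_realRatio_term_ae_eq μ s hden hden_top hnum_top hsupp)

end FibreAE

/-! ### Over `Setup`: the normalised term and (0.4) for integrable pieces -/

section SetupInt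

variable {P : Params} {j : ℕ} {G : Type*} [GaugeGroup G] [MeasurableSpace G] [HaarData G]
variable [DecidableEq (PBond P j)]

/-- The `ℝ≥0∞` fibre integral `∫dV⌈_{Z′}(ofReal ∘ f)` of a measurable density is measurable (Mathlib `Measurable.lmarginal`). [folklore] -/
private theorem measurable_lmarginal_ofReal (s : Finset (PBond P j)) {f : Density P j G} (hf : Measurable f) :
    Measurable (∫⋯∫⁻_s, (fun U => ENNReal.ofReal (f U)) ∂(fun _ : PBond P j => (HaarData.haar : Measure G))) :=
  (ofReal_comp_measurable hf).lmarginal _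

/-- `∫dV⌈_{Z′} f` of a measurable density is measurable (in-cone one-liner, as FILE 12's private copy). [folklore] -/
private theorem measurable_fibreIntegral₀ (s : Finset (PBond P j)) {f : Density P j G} (hf : Measurable f) :
    Measurable (fibreIntegral s f) :=
  (measurable_lmarginal_ofReal s hf).ennreal_toReal

/-- The normalised (0.3)-term `new·∫dV⌈old ∕ ∫dV⌈new` of measurable pieces is measurable. [cite: Balaban1989LargeFieldI, (0.3) p.176 (bookkeeping)] -/
theorem measurable_normTerm (s : Finset (PBond P j)) {new old : Density P j G} (hnew_m : Measurable new) (hold_m : Measurable old) :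
    Measurable (normTerm s new old) :=
  hnew_m.mul ((measurable_fibreIntegral₀ s hold_m).div (measurable_fibreIntegral₀ s hnew_m))

/-- **A total integral is the integral of the fibre integral**: `∫dV (∫dV⌈_{Z′} ofReal∘f) = ∫dV ofReal∘f` over `Setup.fieldMeasure` (b01 `lintegral_lmarginal_eq`
at the normalised Haar fibres). [cite: Balaban1989LargeFieldI, (0.4) p.176 (bookkeeping)] -/
theorem lintegral_lmarginal_ofReal_eq (s : Finset (PBond P j)) {f : Density P j G} (hf : Measurable f) :
    ∫⁻ V, (∫⋯∫⁻_s, (fun U => ENNReal.ofReal (f U)) ∂(fun _ : PBond P j => (HaarData.haar : Measure G))) V ∂(fieldMeasure P j G)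
      = ∫⁻ V, ENNReal.ofReal (f V) ∂(fieldMeasure P j G) := by
  rw [fieldMeasure_eq_pi]
  exact lintegral_lmarginal_eq _ s (ofReal_comp_measurable hf)

/-- **An integrable density has finite fibre integrals ALMOST everywhere** (its `ℝ≥0∞` fibre integral has finite total integral). This replaces b01's
`lmarginal_ofReal_le` (bounded ⇒ finite EVERYWHERE). [cite: Balaban1989LargeFieldI, (0.3) p.176 (bookkeeping: the denominators of (0.3) are finite a.e.)] -/
theorem lmarginal_ofReal_ae_ne_top (s : Finset (PBond P j)) {f : Density P j G} (hf : Measurable f)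
    (hfin : ∫⁻ V, ENNReal.ofReal (f V) ∂(fieldMeasure P j G) ≠ ∞) :
    ∀ᵐ V ∂(fieldMeasure P j G), (∫⋯∫⁻_s, (fun U => ENNReal.ofReal (f U)) ∂(fun _ : PBond P j => (HaarData.haar : Measure G))) V ≠ ∞ :=
  (ae_lt_top (measurable_lmarginal_ofReal s hf) (ne_of_eq_of_ne (lintegral_lmarginal_ofReal_eq s hf) hfin)).mono
    fun _ hV => hV.ne

omit [DecidableEq (PBond P j)] in
/-- For an integrable density that is `≥ 0` a.e., `∫dV ofReal∘f` is finite. [folklore] -/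
private theorem lintegral_ofReal_ne_top_of_integrable {f : Density P j G} (hf : Integrable f (fieldMeasure P j G))
    (h0 : ∀ᵐ V ∂(fieldMeasure P j G), 0 ≤ f V) : ∫⁻ V, ENNReal.ofReal (f V) ∂(fieldMeasure P j G) ≠ ∞ :=
  ((hasFiniteIntegral_iff_ofReal h0).1 hf.hasFiniteIntegral).ne

/-- **THE A.E. SUPPORT CLAUSE ON A PIECE GIVES THE A.E. CLAUSE ON ITS FIBRE INTEGRAL**: if for `dV`-a.e. `V` *«∫dV⌈_{Z′} new = 0 at V ⇒ old(V) = 0»*, then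
for `dV`-a.e. `V` *«∫⌈_{Z′}(ofReal∘new) = 0 at V ⇒ ∫⌈_{Z′}(ofReal∘old) = 0 at V»* (cut `ofReal∘old` off by the fibre-constant indicator of
`{∫⌈ new = 0}`; the product vanishes a.e., hence — FILE 12's `lmarginal_congr_ae` — so does its fibre integral, which is the indicator times `∫⌈ old`).
[cite: Balaban1989LargeFieldI, (0.3) p.176 («the integration domains … are nonempty, hence the denominators are positive», a.e. reading)] -/
theorem lmarginal_supp_ae_of_suppAE (s : Finset (PBond P j)) {new old : Density P j G} (hold_m : Measurable old)
    (hsupp : ∀ᵐ V ∂(fieldMeasure P j G), fibreIntegral s new V = 0 → old V = 0) :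
    ∀ᵐ V ∂(fieldMeasure P j G),
      (∫⋯∫⁻_s, (fun U => ENNReal.ofReal (new U)) ∂(fun _ : PBond P j => (HaarData.haar : Measure G))) V = 0 →
        (∫⋯∫⁻_s, (fun U => ENNReal.ofReal (old U)) ∂(fun _ : PBond P j => (HaarData.haar : Measure G))) V = 0 := by
  classical
  have hold_m' : Measurable (fun U : PBond P j → G => ENNReal.ofReal (old U)) := ENNReal.measurable_ofReal.comp hold_m
  -- the fibre-constant cut-off `c = 𝟙{∫⌈ new = 0}`
  let c : (PBond P j → G) → ℝ≥0∞ := fun V =>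
    if (∫⋯∫⁻_s, (fun U => ENNReal.ofReal (new U)) ∂(fun _ : PBond P j => (HaarData.haar : Measure G))) V = 0 then 1 else 0
  have hc : IndepOf s c := by
    intro x y
    simp only [c, indepOf_lmarginal (fun _ : PBond P j => (HaarData.haar : Measure G)) s _ x y]
  have hg : (c * fun U : PBond P j → G => ENNReal.ofReal (old U)) =ᵐ[fieldMeasure P j G] fun _ => 0 := by
    filter_upwards [hsupp] with V hV
    simp only [Pi.mul_apply, c]
    split_ifs with h
    · have hfib : fibreIntegral s new V = 0 := by simp only [fibreIntegral, h, ENNReal.toReal_zero]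
      rw [hV hfib, ENNReal.ofReal_zero, mul_zero]
    · rw [zero_mul]
  have hm : ∫⋯∫⁻_s, (c * fun U : PBond P j → G => ENNReal.ofReal (old U)) ∂(fun _ : PBond P j => (HaarData.haar : Measure G))
      =ᵐ[fieldMeasure P j G] ∫⋯∫⁻_s, (fun _ => (0 : ℝ≥0∞)) ∂(fun _ : PBond P j => (HaarData.haar : Measure G)) :=
    lmarginal_congr_ae (fun _ : PBond P j => (HaarData.haar : Measure G)) s hg
  have h0 : ∫⋯∫⁻_s, (fun _ => (0 : ℝ≥0∞)) ∂(fun _ : PBond P j => (HaarData.haar : Measure G)) = fun _ => 0 := by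
    ext x; simp [lmarginal]
  rw [lmarginal_mul_of_indepOf s hc hold_m', h0] at hm
  filter_upwards [hm] with V hV hLn
  have hV' : (if (∫⋯∫⁻_s, (fun U => ENNReal.ofReal (new U)) ∂(fun _ : PBond P j => (HaarData.haar : Measure G))) V = 0
      then (1 : ℝ≥0∞) else 0) *
        (∫⋯∫⁻_s, (fun U => ENNReal.ofReal (old U)) ∂(fun _ : PBond P j => (HaarData.haar : Measure G))) V = 0 := hV
  rw [if_pos hLn, one_mul] at hV'
  exact hV'

/-- **`∫dV ofReal∘[new·∫dV⌈old ∕ ∫dV⌈new] = ∫dV ofReal∘old` FOR INTEGRABLE PIECES**: `new, old` measurable with `∫dV ofReal∘new`, `∫dV ofReal∘old` finite and the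
support clause *«∫dV⌈_{Z′} new = 0 at V ⇒ old(V) = 0»* ALMOST everywhere — n10-b's identity with the uniform bound replaced by integrability (the bound served
only to make the fibre integrals finite; here they are finite a.e., `lmarginal_ofReal_ae_ne_top`). [cite: Balaban1989LargeFieldI, (1.102) p.201; Balaban1989LargeFieldI, (0.4) p.176] -/
theorem lintegral_ofReal_normTerm_eq_int (s : Finset (PBond P j)) {new old : Density P j G} (hnew_m : Measurable new) (hold_m : Measurable old)
    (hnew_i : ∫⁻ V, ENNReal.ofReal (new V) ∂(fieldMeasure P j G) ≠ ∞) (hold_i : ∫⁻ V, ENNReal.ofReal (old V) ∂(fieldMeasure P j G) ≠ ∞)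
    (hsupp : ∀ᵐ V ∂(fieldMeasure P j G), fibreIntegral s new V = 0 → old V = 0) :
    ∫⁻ V, ENNReal.ofReal (normTerm s new old V) ∂(fieldMeasure P j G) = ∫⁻ V, ENNReal.ofReal (old V) ∂(fieldMeasure P j G) := by
  have hpt : (fun V => ENNReal.ofReal (normTerm s new old V)) = fun V => ENNReal.ofReal (new V) *
      ENNReal.ofReal (((∫⋯∫⁻_s, (fun U => ENNReal.ofReal (old U)) ∂(fun _ : PBond P j => (HaarData.haar : Measure G))) V).toReal /
        ((∫⋯∫⁻_s, (fun U => ENNReal.ofReal (new U)) ∂(fun _ : PBond P j => (HaarData.haar : Measure G))) V).toReal) := by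
    funext V
    simp only [normTerm, fibreIntegral]
    exact ENNReal.ofReal_mul' (div_nonneg ENNReal.toReal_nonneg ENNReal.toReal_nonneg)
  have h1 := lmarginal_ofReal_ae_ne_top s hnew_m hnew_i
  have h2 := lmarginal_ofReal_ae_ne_top s hold_m hold_i
  have h3 := lmarginal_supp_ae_of_suppAE s hold_m hsupp
  rw [hpt, fieldMeasure_eq_pi]
  rw [fieldMeasure_eq_pi] at h1 h2 h3
  exact lintegral_realRatio_term_eq (fun _ : PBond P j => (HaarData.haar : Measure G)) s (ofReal_comp_measurable hold_m)
    (ofReal_comp_measurable hnew_m) h1 h2 h3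

/-- **(1.102) FOR ONE RENORMALISED COMPONENT, INTEGRABLE FORM**: for measurable `new, old ≥ 0` that are INTEGRABLE and satisfy the support clause ALMOST everywhere,
`∫dV [new · ∫dV⌈old ∕ ∫dV⌈new] = ∫dV old` — n10-b's `integral_normTerm_eq_supp` ∕ FILE 12's `…_suppAE` WITHOUT the uniform bound `≤ C`.
[cite: Balaban1989LargeFieldI, (1.102) p.201; Balaban1989LargeFieldI, (0.4) p.176] -/
theorem integral_normTerm_eq_int (s : Finset (PBond P j)) {new old : Density P j G} (hnew_m : Measurable new) (hold_m : Measurable old)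
    (hnew0 : ∀ V, 0 ≤ new V) (hold0 : ∀ V, 0 ≤ old V) (hnew_i : Integrable new (fieldMeasure P j G)) (hold_i : Integrable old (fieldMeasure P j G))
    (hsupp : ∀ᵐ V ∂(fieldMeasure P j G), fibreIntegral s new V = 0 → old V = 0) :
    ∫ V, normTerm s new old V ∂(fieldMeasure P j G) = ∫ V, old V ∂(fieldMeasure P j G) := by
  have hnt0 : ∀ V, 0 ≤ normTerm s new old V := fun V =>
    mul_nonneg (hnew0 V) (div_nonneg ENNReal.toReal_nonneg ENNReal.toReal_nonneg)
  rw [integral_eq_lintegral_of_nonneg_ae (Filter.Eventually.of_forall hnt0) (measurable_normTerm s hnew_m hold_m).aestronglyMeasurable,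
    integral_eq_lintegral_of_nonneg_ae (Filter.Eventually.of_forall hold0) hold_m.aestronglyMeasurable,
    lintegral_ofReal_normTerm_eq_int s hnew_m hold_m (lintegral_ofReal_ne_top_of_integrable hnew_i (Filter.Eventually.of_forall hnew0))
      (lintegral_ofReal_ne_top_of_integrable hold_i (Filter.Eventually.of_forall hold0)) hsupp]

/-- Integrability of the normalised term under the integrable form WITH the support clause (its `ℝ≥0∞` integral is that of `old`).  Without the clause see K0c's
`Node00.integrable_normTerm_of_integrable` (the fibre INEQUALITY). [cite: Balaban1989LargeFieldI, (1.102) p.201 (bookkeeping)] -/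
theorem integrable_normTerm_int (s : Finset (PBond P j)) {new old : Density P j G} (hnew_m : Measurable new) (hold_m : Measurable old)
    (hnew0 : ∀ V, 0 ≤ new V) (hold0 : ∀ V, 0 ≤ old V) (hnew_i : Integrable new (fieldMeasure P j G)) (hold_i : Integrable old (fieldMeasure P j G))
    (hsupp : ∀ᵐ V ∂(fieldMeasure P j G), fibreIntegral s new V = 0 → old V = 0) :
    Integrable (normTerm s new old) (fieldMeasure P j G) := by
  have hnt0 : ∀ V, 0 ≤ normTerm s new old V := fun V =>
    mul_nonneg (hnew0 V) (div_nonneg ENNReal.toReal_nonneg ENNReal.toReal_nonneg)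
  refine ⟨(measurable_normTerm s hnew_m hold_m).aestronglyMeasurable, ?_⟩
  rw [hasFiniteIntegral_iff_ofReal (Filter.Eventually.of_forall hnt0),
    lintegral_ofReal_normTerm_eq_int s hnew_m hold_m (lintegral_ofReal_ne_top_of_integrable hnew_i (Filter.Eventually.of_forall hnew0))
      (lintegral_ofReal_ne_top_of_integrable hold_i (Filter.Eventually.of_forall hold0)) hsupp]
  exact (lintegral_ofReal_ne_top_of_integrable hold_i (Filter.Eventually.of_forall hold0)).lt_top

omit [DecidableEq (PBond P j)] in
/-- **A NON-NEGATIVE MEASURABLE MODIFICATION**: an a.e.-strongly measurable density with `0 ≤ f` almost everywhere has a MEASURABLE version `f′ = max 0 f̃` (`f̃` a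
strongly measurable version) with `0 ≤ f′` EVERYWHERE and `f = f′` a.e. (FILE 12's `exists_measurable_modification` without the clip at `C`).
[cite: Balaban1989LargeFieldI, (0.3) p.176 (measure-theoretic bookkeeping: «the densities are positive» read almost everywhere)] -/
theorem exists_measurable_nonneg_modification {f : Density P j G} (hf : AEStronglyMeasurable f (fieldMeasure P j G))
    (h0 : ∀ᵐ V ∂(fieldMeasure P j G), 0 ≤ f V) :
    ∃ f' : Density P j G, Measurable f' ∧ f =ᵐ[fieldMeasure P j G] f' ∧ ∀ V, 0 ≤ f' V := by
  refine ⟨fun V => max 0 (hf.mk f V), measurable_const.max hf.stronglyMeasurable_mk.measurable, ?_, fun V => le_max_left _ _⟩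
  filter_upwards [hf.ae_eq_mk, h0] with V hV h0V
  rw [← hV, max_eq_right h0V]

/-- **(0.4) over `Setup`, INTEGRABLE FORM**: pieces INTEGRABLE, `0 ≤ ρ(Z,·)` a.e., and the support clause *«where `∫dV⌈_{Z′}ρ(Z″,·)` vanishes, `ρ(Z,·)` vanishes»*
a.e.; conclusion `∫dV (ℝρ)(V) = ∫dV Σ_Z ρ(Z, V)` for the ORIGINAL pieces — b01's `integral_ropReal_eq` ∕ n10-b's `_supp` ∕ FILE 12's `_ess` with NO uniform bound.
Proof: non-negative measurable modifications, the a.e. clause moved onto them (FILE 12 `suppClause_congr_ae`), `integral_normTerm_eq_int` termwise, and back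
along FILE 12's `normTerm_congr_ae`. [cite: Balaban1989LargeFieldI, (0.4) p.176; Balaban1989LargeFieldI, (1.102) p.201] -/
theorem integral_ropReal_eq_int {R : Type*} [Fintype R] (piece : R → Density P j G) (pp : R → R) (fib : R → Finset (PBond P j))
    (hi : ∀ Z, Integrable (piece Z) (fieldMeasure P j G)) (h0 : ∀ Z, ∀ᵐ V ∂(fieldMeasure P j G), 0 ≤ piece Z V)
    (hsupp : ∀ Z, ∀ᵐ V ∂(fieldMeasure P j G), fibreIntegral (fib Z) (piece (pp Z)) V = 0 → piece Z V = 0) :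
    ∫ V, RopReal piece pp fib V ∂(fieldMeasure P j G) = ∫ V, ∑ Z, piece Z V ∂(fieldMeasure P j G) := by
  choose piece' hm' hae h0' using fun Z => exists_measurable_nonneg_modification (hi Z).1 (h0 Z)
  have hi' : ∀ Z, Integrable (piece' Z) (fieldMeasure P j G) := fun Z => (hi Z).congr (hae Z)
  have hsupp' : ∀ Z, ∀ᵐ V ∂(fieldMeasure P j G), fibreIntegral (fib Z) (piece' (pp Z)) V = 0 → piece' Z V = 0 :=
    fun Z => suppClause_congr_ae (fib Z) (hae (pp Z)) (hae Z) (hsupp Z)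
  have hnt : ∀ Z, normTerm (fib Z) (piece (pp Z)) (piece Z)
      =ᵐ[fieldMeasure P j G] normTerm (fib Z) (piece' (pp Z)) (piece' Z) :=
    fun Z => normTerm_congr_ae (fib Z) (hae (pp Z)) (hae Z)
  have hint : ∀ Z, Integrable (normTerm (fib Z) (piece (pp Z)) (piece Z)) (fieldMeasure P j G) := fun Z =>
    (Node00.integrable_normTerm_of_integrable (fib Z) (hm' _) (hm' _) (h0' _) (h0' _) (hi' Z)).congr (hnt Z).symm
  simp only [RopReal]
  rw [integral_finsetSum _ (fun Z _ => hint Z), integral_finsetSum _ (fun Z _ => hi Z)]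
  refine Finset.sum_congr rfl fun Z _ => ?_
  rw [integral_congr_ae (hnt Z), integral_normTerm_eq_int (fib Z) (hm' _) (hm' _) (h0' _) (h0' _) (hi' _) (hi' _) (hsupp' Z)]
  exact integral_congr_ae (hae Z).symm

/-- **Integrability of (0.3), INTEGRABLE FORM — NO support clause**: for INTEGRABLE pieces with `0 ≤ ρ(Z,·)` a.e., `ℝρ` is `dV`-integrable (termwise K0c's fibre
inequality `Node00.integrable_normTerm_of_integrable` on non-negative measurable modifications, transferred along FILE 12's `normTerm_congr_ae`).
[cite: Balaban1989LargeFieldI, (0.3)–(0.4) p.176 (bookkeeping)] -/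
theorem integrable_ropReal_int {R : Type*} [Fintype R] (piece : R → Density P j G) (pp : R → R) (fib : R → Finset (PBond P j))
    (hi : ∀ Z, Integrable (piece Z) (fieldMeasure P j G)) (h0 : ∀ Z, ∀ᵐ V ∂(fieldMeasure P j G), 0 ≤ piece Z V) :
    Integrable (RopReal piece pp fib) (fieldMeasure P j G) := by
  choose piece' hm' hae h0' using fun Z => exists_measurable_nonneg_modification (hi Z).1 (h0 Z)
  have hint : ∀ Z, Integrable (normTerm (fib Z) (piece (pp Z)) (piece Z)) (fieldMeasure P j G) := fun Z =>
    (Node00.integrable_normTerm_of_integrable (fib Z) (hm' _) (hm' _) (h0' _) (h0' _) ((hi Z).congr (hae Z))).congr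
      (normTerm_congr_ae (fib Z) (hae (pp Z)) (hae Z)).symm
  have hR : RopReal piece pp fib = fun V => ∑ Z, normTerm (fib Z) (piece (pp Z)) (piece Z) V := rfl
  rw [hR]
  exact integrable_finsetSum _ fun Z _ => hint Z

/-- **THE SUPPORT CLAUSE IS AUTOMATIC AT `Z″ := Z` (measurable form)**: for a measurable `f ≥ 0` with `∫dV ofReal∘f` finite, *«∫dV⌈_{Z′} f = 0 at V ⇒ f(V) = 0»*
holds for `dV`-ALMOST EVERY `V`: on the (fibre-cylindrical, measurable) set where the fibre integral vanishes, `f` has total integral `∫ 𝟙·∫⌈f = 0`, so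
vanishes a.e. there; the `toReal = 0` reading also covers `∫⌈ f = ∞`, a null set. [cite: Balaban1989LargeFieldI, (0.3) p.176 («the densities are positive … hence the denominators are positive», a.e. reading at `Z″ = Z`)] -/
theorem suppClause_self_ae_of_measurable (s : Finset (PBond P j)) {f : Density P j G} (hm : Measurable f) (h0 : ∀ V, 0 ≤ f V)
    (hfin : ∫⁻ V, ENNReal.ofReal (f V) ∂(fieldMeasure P j G) ≠ ∞) :
    ∀ᵐ V ∂(fieldMeasure P j G), fibreIntegral s f V = 0 → f V = 0 := by
  classical
  have hm' : Measurable (fun U : PBond P j → G => ENNReal.ofReal (f U)) := ENNReal.measurable_ofReal.comp hm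
  have htop := lmarginal_ofReal_ae_ne_top s hm hfin
  have hA : MeasurableSet {V : PBond P j → G |
      (∫⋯∫⁻_s, (fun U => ENNReal.ofReal (f U)) ∂(fun _ : PBond P j => (HaarData.haar : Measure G))) V = 0} :=
    measurable_lmarginal_ofReal s hm (measurableSet_singleton 0)
  -- the fibre-constant cut-off `c = 𝟙{∫⌈ f = 0}`
  let c : (PBond P j → G) → ℝ≥0∞ := fun V =>
    if (∫⋯∫⁻_s, (fun U => ENNReal.ofReal (f U)) ∂(fun _ : PBond P j => (HaarData.haar : Measure G))) V = 0 then 1 else 0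
  have hc : IndepOf s c := by
    intro x y
    simp only [c, indepOf_lmarginal (fun _ : PBond P j => (HaarData.haar : Measure G)) s _ x y]
  have hc_m : Measurable c := Measurable.ite hA measurable_const measurable_const
  -- its fibre integral against `ofReal∘f` vanishes identically
  have hmarg : ∫⋯∫⁻_s, (c * fun U : PBond P j → G => ENNReal.ofReal (f U)) ∂(fun _ : PBond P j => (HaarData.haar : Measure G))
      = fun _ => 0 := by
    rw [lmarginal_mul_of_indepOf s hc hm']
    funext V
    simp only [Pi.mul_apply, c]
    split_ifs with h
    · rw [h, mul_zero]
    · rw [zero_mul]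
  -- hence `c · ofReal∘f` has total integral zero and vanishes a.e.
  have hlint : ∫⁻ V, (c * fun U : PBond P j → G => ENNReal.ofReal (f U)) V ∂(fieldMeasure P j G) = 0 := by
    have h := lintegral_lmarginal_eq (fun _ : PBond P j => (HaarData.haar : Measure G)) s (hc_m.mul hm')
    rw [hmarg, lintegral_zero] at h
    exact h.symm
  have hae : (c * fun U : PBond P j → G => ENNReal.ofReal (f U)) =ᵐ[fieldMeasure P j G] 0 :=
    (lintegral_eq_zero_iff (hc_m.mul hm')).1 hlint
  filter_upwards [hae, htop] with V hV hVtop hfib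
  have hzero : (∫⋯∫⁻_s, (fun U => ENNReal.ofReal (f U)) ∂(fun _ : PBond P j => (HaarData.haar : Measure G))) V = 0 := by
    simp only [fibreIntegral] at hfib
    exact (ENNReal.toReal_eq_zero_iff _).1 hfib |>.resolve_right hVtop
  have hV' : (if (∫⋯∫⁻_s, (fun U => ENNReal.ofReal (f U)) ∂(fun _ : PBond P j => (HaarData.haar : Measure G))) V = 0
      then (1 : ℝ≥0∞) else 0) * ENNReal.ofReal (f V) = 0 := hV
  rw [if_pos hzero, one_mul, ENNReal.ofReal_eq_zero] at hV'
  exact le_antisymm hV' (h0 V)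

/-- **THE SUPPORT CLAUSE IS AUTOMATIC AT `Z″ := Z`**: for an INTEGRABLE density `f` with `0 ≤ f` almost everywhere, *«∫dV⌈_{Z′} f = 0 at V ⇒ f(V) = 0»* holds for
`dV`-ALMOST EVERY `V` (the measurable form on a non-negative measurable version, transferred along FILE 12's `fibreIntegral_congr_ae`).  This is the third conjunct
of `RepData.ProvisosInt` at a datum whose `p–p′` selector is the identity — the selector of every carrier of record so far.
[cite: Balaban1989LargeFieldI, (0.3) p.176 («hence the denominators are positive», a.e. reading at `Z″ = Z`)] -/
theorem suppClause_self_ae (s : Finset (PBond P j)) {f : Density P j G} (hf : Integrable f (fieldMeasure P j G))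
    (h0 : ∀ᵐ V ∂(fieldMeasure P j G), 0 ≤ f V) :
    ∀ᵐ V ∂(fieldMeasure P j G), fibreIntegral s f V = 0 → f V = 0 := by
  obtain ⟨f', hm', hae, h0'⟩ := exists_measurable_nonneg_modification hf.1 h0
  have h := suppClause_self_ae_of_measurable s hm' h0'
    (lintegral_ofReal_ne_top_of_integrable (hf.congr hae) (Filter.Eventually.of_forall h0'))
  filter_upwards [h, fibreIntegral_congr_ae s hae, hae] with V h1 h2 h3
  intro hV
  rw [h3]
  exact h1 (by rw [← h2]; exact hV)

/-- **A DEAD PIECE VANISHES ALMOST EVERYWHERE**: an integrable `f` with `0 ≤ f` a.e. such that at EVERY `V` either `f(V) = 0` or `∫dV⌈_{Z′} f = 0 at V` is `0`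
for `dV`-almost every `V` (`suppClause_self_ae`).  The (0.3) support conjunct of such a piece is trivial WHATEVER `Z″` is — so a selector may move dead
pieces freely. [cite: Balaban1989LargeFieldI, (0.3) p.176 (a.e. reading of «the densities are positive … hence the denominators are positive»)] -/
theorem ae_eq_zero_of_self_or_fibreIntegral_eq_zero (s : Finset (PBond P j)) {f : Density P j G} (hf : Integrable f (fieldMeasure P j G))
    (h0 : ∀ᵐ V ∂(fieldMeasure P j G), 0 ≤ f V) (hdead : ∀ V, f V = 0 ∨ fibreIntegral s f V = 0) :
    ∀ᵐ V ∂(fieldMeasure P j G), f V = 0 := by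
  filter_upwards [suppClause_self_ae s hf h0] with V hV
  rcases hdead V with h | h
  · exact h
  · exact hV h

end SetupInt

end Literature.MathematicalPhysics.QuantumFieldTheory.Balaban1983to89.B15.BasicStep

/-! ## §2  THE DATUM: the integrable-form provisos of a representation datum and their certificates -/

namespace Literature.MathematicalPhysics.QuantumFieldTheory.Balaban1983to89.B15RopTotal

open B15.BasicStep (fibreIntegral normTerm RopReal integral_ropReal_eq_int integrable_ropReal_int ropReal_nonneg_ae
  integrable_of_ae_bdd suppClause_self_ae ae_eq_zero_of_self_or_fibreIntegral_eq_zero)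

variable {P : Params} {j : ℕ} {G : Type*} [GaugeGroup G] [MeasurableSpace G] [HaarData G]

namespace RepData

variable (d : RepData P j G)

/-- **THE PROVISOS OF p. 176 IN INTEGRABLE FORM** for the datum: every piece `ρ(Z,·)` INTEGRABLE for `dV`, `0 ≤ ρ(Z,·)` ALMOST EVERYWHERE, and the support
reading of *«the denominators are positive»* ALMOST EVERYWHERE: for `dV`-a.e. `V`, if `∫dV⌈_{Z′}ρ(Z″,·)` vanishes at `V` then `ρ(Z, V) = 0`.  FILE 12's
`ProvisosEss` without the essential uniform bound (integrability in its place); a `Prop` with body about the datum (no fact is named).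
[cite: Balaban1989LargeFieldI, (0.3) p.176] -/
def ProvisosInt [DecidableEq (PBond P j)] : Prop :=
  (∀ Z, Integrable (d.piece Z) (fieldMeasure P j G)) ∧ (∀ Z, ∀ᵐ V ∂(fieldMeasure P j G), 0 ≤ d.piece Z V) ∧
    ∀ Z, ∀ᵐ V ∂(fieldMeasure P j G), fibreIntegral (d.fib Z) (d.piece (d.pp Z)) V = 0 → d.piece Z V = 0

/-- The essential-form provisos imply the integrable form (a.e.-bounded a.e.-strongly measurable non-negative pieces are integrable, FILE 12
`integrable_of_ae_bdd`). [cite: Balaban1989LargeFieldI, (0.3) p.176 (bookkeeping)] -/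
theorem provisosInt_of_provisosEss [DecidableEq (PBond P j)] (h : d.ProvisosEss) : d.ProvisosInt := by
  obtain ⟨hm, h0, ⟨C, hC⟩, hsupp⟩ := h
  exact ⟨fun Z => integrable_of_ae_bdd (hm Z) (h0 Z) (hC Z), h0, hsupp⟩

/-- The support-form provisos (as typed, pointwise) imply the integrable form. [cite: Balaban1989LargeFieldI, (0.3) p.176 (bookkeeping)] -/
theorem provisosInt_of_provisosSupp [DecidableEq (PBond P j)] (h : d.ProvisosSupp) : d.ProvisosInt :=
  d.provisosInt_of_provisosEss (d.provisosEss_of_provisosSupp h)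

/-- The standard provisos imply the integrable form. [cite: Balaban1989LargeFieldI, (0.3) p.176 (bookkeeping)] -/
theorem provisosInt_of_provisos [DecidableEq (PBond P j)] (h : d.Provisos) : d.ProvisosInt :=
  d.provisosInt_of_provisosEss (d.provisosEss_of_provisos h)

/-- **(0.4) FOR THE DATUM under the integrable-form provisos**: `∫dV (𝐑ρ)(V) = ∫dV ρ(V)` with `𝐑ρ = d.rop`, `ρ = d.total` (`integral_ropReal_eq_int` at the
datum's own `Fintype` structure). [cite: Balaban1989LargeFieldI, (0.4) p.176] -/
theorem integral_rop_eq_of_provisosInt [DecidableEq (PBond P j)] (h : d.ProvisosInt) :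
    ∫ V, d.rop V ∂(fieldMeasure P j G) = ∫ V, d.total V ∂(fieldMeasure P j G) := by
  letI := d.fin
  obtain ⟨hi, h0, hsupp⟩ := h
  exact integral_ropReal_eq_int d.piece d.pp d.fib hi h0 hsupp

/-- **Integrability of (0.3) of the datum** under the integrable-form provisos (conjuncts 1–2 only; the support clause is not used).
[cite: Balaban1989LargeFieldI, (0.3)–(0.4) p.176 (bookkeeping)] -/
theorem integrable_rop_of_provisosInt [DecidableEq (PBond P j)] (h : d.ProvisosInt) : Integrable d.rop (fieldMeasure P j G) := by
  letI := d.fin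
  exact integrable_ropReal_int d.piece d.pp d.fib h.1 h.2.1

/-- `0 ≤ 𝐑ρ` almost everywhere under the integrable-form provisos. [cite: Balaban1989LargeFieldI, (0.3) p.176 (bookkeeping)] -/
theorem rop_nonneg_ae_of_provisosInt [DecidableEq (PBond P j)] (h : d.ProvisosInt) :
    ∀ᵐ V ∂(fieldMeasure P j G), 0 ≤ d.rop V := by
  letI := d.fin
  exact ropReal_nonneg_ae d.piece d.pp d.fib h.2.1

/-- The represented density `Σ_Z ρ(Z,·)` is integrable under the integrable-form provisos. [cite: Balaban1989LargeFieldI, (0.2) p.176 (bookkeeping)] -/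
theorem integrable_total_of_provisosInt [DecidableEq (PBond P j)] (h : d.ProvisosInt) :
    Integrable d.total (fieldMeasure P j G) := by
  letI := d.fin
  have ht : d.total = fun V => ∑ Z, d.piece Z V := rfl
  rw [ht]
  exact integrable_finsetSum _ fun Z _ => h.1 Z

/-- **AT A DATUM WHOSE `p–p′` SELECTOR IS THE IDENTITY THE SUPPORT CONJUNCT DROPS OUT**: integrable pieces that are `≥ 0` almost everywhere satisfy the
integrable-form provisos (`suppClause_self_ae`). [cite: Balaban1989LargeFieldI, (0.3) p.176 («hence the denominators are positive», a.e. reading at `Z″ = Z`)] -/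
theorem provisosInt_of_pp_eq_self [DecidableEq (PBond P j)] (hpp : ∀ Z, d.pp Z = Z)
    (hi : ∀ Z, Integrable (d.piece Z) (fieldMeasure P j G)) (h0 : ∀ Z, ∀ᵐ V ∂(fieldMeasure P j G), 0 ≤ d.piece Z V) : d.ProvisosInt := by
  refine ⟨hi, h0, fun Z => ?_⟩
  rw [hpp Z]
  exact suppClause_self_ae (d.fib Z) (hi Z) (h0 Z)

/-- **AT A DATUM WHOSE SELECTOR MOVES ONLY DEAD PIECES THE SUPPORT CONJUNCT DROPS OUT**: if every `Z` is a fixed point of `Z ↦ Z″` or DEAD (at every `V`,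
`ρ(Z, V) = 0` or `∫dV⌈_{Z′}ρ(Z,·) = 0 at V`), integrable pieces `≥ 0` a.e. satisfy the integrable-form provisos (fixed points: `suppClause_self_ae`; dead pieces
vanish a.e., `ae_eq_zero_of_self_or_fibreIntegral_eq_zero`). [cite: Balaban1989LargeFieldI, (0.3) p.176 («hence the denominators are positive», a.e. reading)] -/
theorem provisosInt_of_pp_fixed_or_null [DecidableEq (PBond P j)]
    (hpp : ∀ Z, d.pp Z = Z ∨ ∀ V, d.piece Z V = 0 ∨ fibreIntegral (d.fib Z) (d.piece Z) V = 0)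
    (hi : ∀ Z, Integrable (d.piece Z) (fieldMeasure P j G)) (h0 : ∀ Z, ∀ᵐ V ∂(fieldMeasure P j G), 0 ≤ d.piece Z V) : d.ProvisosInt := by
  refine ⟨hi, h0, fun Z => ?_⟩
  rcases hpp Z with hZ | hZ
  · rw [hZ]
    exact suppClause_self_ae (d.fib Z) (hi Z) (h0 Z)
  · filter_upwards [ae_eq_zero_of_self_or_fibreIntegral_eq_zero (d.fib Z) (hi Z) (h0 Z) hZ] with V hV
    exact fun _ => hV

end RepData

end Literature.MathematicalPhysics.QuantumFieldTheory.Balaban1983to89.B15RopTotal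

/-! ## §3  THE FORM AND THE PINS -/

namespace Literature.MathematicalPhysics.QuantumFieldTheory.Balaban1983to89.Node00

open T4Continuum B15RopTotal
open B15.BasicStep (fibreIntegral normTerm RopReal suppClause_self_ae ae_eq_zero_of_self_or_fibreIntegral_eq_zero)

section Form

variable {P : Params} {j : ℕ} {G : Type*} [GaugeGroup G] [MeasurableSpace G] [HaarData G]

/-- `ProvisosInt` does not depend on the `DecidableEq (PBond P j)` instance (TS-8). [cite: Balaban1989LargeFieldI, (0.3) p.176 (bookkeeping)] -/
theorem provisosInt_instIrrel (i₁ i₂ : DecidableEq (PBond P j)) (d : RepData P j G) :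
    (haveI := i₁; d.ProvisosInt) ↔ (haveI := i₂; d.ProvisosInt) := by
  cases Subsingleton.elim i₁ i₂
  exact Iff.rfl

/-- **THE INTEGRABLE FORM** — the fourth proviso form beside FILE 9′'s `.std` ∕ `.supp` and FILE 12's `.ess`: predicate `RepData.ProvisosInt`, certificates
`integral_rop_eq_of_provisosInt` ((0.4) for the datum) and `integrable_rop_of_provisosInt` (both PROVED, §1–§2).  The `DecidableEq` structure is an
implicit binder (it unifies from the consumer's `ProvisoForm P j G`, TS-8). [cite: Balaban1989LargeFieldI, (0.3)–(0.4) p.176] -/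
def ProvisoForm.int {instD : DecidableEq (PBond P j)} : ProvisoForm P j G where
  Prov d := d.ProvisosInt
  integral_rop_eq d h := d.integral_rop_eq_of_provisosInt h
  integrable_rop d h := d.integrable_rop_of_provisosInt h

variable [DecidableEq (PBond P j)]

/-- The integrable form's predicate is `RepData.ProvisosInt`. [cite: Balaban1989LargeFieldI, (0.3) p.176 (bookkeeping)] -/
theorem ProvisoForm.int_prov_iff (d : RepData P j G) :
    (ProvisoForm.int : ProvisoForm P j G).Prov d ↔ d.ProvisosInt := Iff.rfl

/-- The essential form implies the integrable form. [cite: Balaban1989LargeFieldI, (0.3) p.176 (bookkeeping)] -/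
theorem ProvisoForm.int_of_ess (d : RepData P j G) (h : (ProvisoForm.ess : ProvisoForm P j G).Prov d) :
    (ProvisoForm.int : ProvisoForm P j G).Prov d :=
  d.provisosInt_of_provisosEss h

/-- The support form implies the integrable form. [cite: Balaban1989LargeFieldI, (0.3) p.176 (bookkeeping)] -/
theorem ProvisoForm.int_of_supp (d : RepData P j G) (h : (ProvisoForm.supp : ProvisoForm P j G).Prov d) :
    (ProvisoForm.int : ProvisoForm P j G).Prov d :=
  d.provisosInt_of_provisosSupp h

/-- The standard form implies the integrable form. [cite: Balaban1989LargeFieldI, (0.3) p.176 (bookkeeping)] -/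
theorem ProvisoForm.int_of_std (d : RepData P j G) (h : (ProvisoForm.std : ProvisoForm P j G).Prov d) :
    (ProvisoForm.int : ProvisoForm P j G).Prov d :=
  d.provisosInt_of_provisos h

/-- v1.4 is admissible wherever v1.3 is (one lattice). [cite: Balaban1989LargeFieldI, (0.3) p.176 (bookkeeping)] -/
theorem admissibleBy_int_of_ess {rep : Density P j G → RepData P j G} {ρ : Density P j G}
    (h : AdmissibleBy ProvisoForm.ess rep ρ) : AdmissibleBy ProvisoForm.int rep ρ :=
  h.mono fun d hd => ProvisoForm.int_of_ess d hd

/-- v1.4 is admissible wherever v1.2 is (one lattice). [cite: Balaban1989LargeFieldI, (0.3) p.176 (bookkeeping)] -/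
theorem admissibleBy_int_of_supp {rep : Density P j G → RepData P j G} {ρ : Density P j G}
    (h : AdmissibleBy ProvisoForm.supp rep ρ) : AdmissibleBy ProvisoForm.int rep ρ :=
  h.mono fun d hd => ProvisoForm.int_of_supp d hd

/-- **On the admissible branch over the integrable form `R ρ ≥ 0` a.e.; off it `R ρ = ρ`**: `R` over the integrable form preserves a.e. non-negativity.
[cite: Balaban1989LargeFieldI, (0.3) p.176 («the densities are positive», weak form)] -/
theorem ropTotalBy_int_nonneg_ae (rep : Density P j G → RepData P j G) {ρ : Density P j G}
    (hρ : ∀ᵐ V ∂(fieldMeasure P j G), 0 ≤ ρ V) : ∀ᵐ V ∂(fieldMeasure P j G), 0 ≤ ropTotalBy ProvisoForm.int rep ρ V := by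
  by_cases h : AdmissibleBy ProvisoForm.int rep ρ
  · rw [ropTotalBy_of_admissible h]
    exact (rep ρ).rop_nonneg_ae_of_provisosInt h.2
  · rw [ropTotalBy_of_not h]
    exact hρ

end Form

section FormInstIrrel

variable {P : Params} {j : ℕ} {G : Type*} [GaugeGroup G] [MeasurableSpace G] [HaarData G]

/-- Admissibility over the integrable form does not depend on the instance. [cite: Balaban1989LargeFieldI, (0.3) p.176 (bookkeeping)] -/
theorem admissibleBy_int_instIrrel (i₁ i₂ : DecidableEq (PBond P j)) (rep : Density P j G → RepData P j G) (ρ : Density P j G) :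
    (haveI := i₁; AdmissibleBy ProvisoForm.int rep ρ) ↔ (haveI := i₂; AdmissibleBy ProvisoForm.int rep ρ) := by
  cases Subsingleton.elim i₁ i₂
  exact Iff.rfl

/-- `ropTotalBy` over the integrable form does not depend on the instance. [cite: Balaban1989LargeFieldI, (0.3) p.176 (bookkeeping)] -/
theorem ropTotalBy_int_instIrrel (i₁ i₂ : DecidableEq (PBond P j)) (rep : Density P j G → RepData P j G) :
    (haveI := i₁; ropTotalBy ProvisoForm.int rep) = (haveI := i₂; ropTotalBy ProvisoForm.int rep) := by
  cases Subsingleton.elim i₁ i₂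
  rfl

end FormInstIrrel

/-! ### The NODE 00 pins over the integrable form (v1.4, OFFERED — the plug of record stays v1.2 `ROp03SuppOfRecord`) -/

section Pin

variable (F : T4Family) (N : ℕ) [NeZero N]

/-- The integrable form at every run and step (the classical `DecidableEq` structure of `ProvisoFormOfRecord` unifies into `ProvisoForm.int`).
[cite: Balaban1989LargeFieldI, (0.3) p.176 (bookkeeping)] -/
def ProvisoFormOfRecord.int : ProvisoFormOfRecord F N := fun _ _ => ProvisoForm.int

/-- **`R` OF RECORD OVER THE INTEGRABLE FORM (v1.4)** at the residual datum `rep` = FILE 9′'s pin `ROp03ByOfRecord` at `ProvisoFormOfRecord.int`: (0.3) of the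
datum on the densities admissible over the INTEGRABLE provisos, the identity elsewhere.  Offered beside the plug of record v1.2 (`ROp03SuppOfRecord`) and v1.3
(`ROp03EssOfRecord`); admissible wherever they are (`admissibleBy_int_of_supp` ∕ `_of_ess`) and also on data with integrable UNBOUNDED pieces — the data of
record. [cite: Balaban1989LargeFieldI, (0.3) p.176] -/
def ROp03IntOfRecord (rep : RepOfRecord F N) (p : B12.RunParams) (k : ℕ) :
    Density (F.P p.K) (k + 1) (SU N) → Density (F.P p.K) (k + 1) (SU N) :=
  ROp03ByOfRecord F N (ProvisoFormOfRecord.int F N) rep p k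

/-- Unfolding of v1.4. [cite: Balaban1989LargeFieldI, (0.3) p.176 (bookkeeping)] -/
theorem ROp03IntOfRecord_eq (rep : RepOfRecord F N) :
    ROp03IntOfRecord F N rep = ROp03ByOfRecord F N (ProvisoFormOfRecord.int F N) rep := rfl

/-- v1.4 at ANY instance: `ropTotalBy ProvisoForm.int` of the datum read with the consumer's instance (TS-8 (iii)). [cite: Balaban1989LargeFieldI, (0.3) p.176 (bookkeeping)] -/
theorem ROp03IntOfRecord_eq_ropTotalBy (rep : RepOfRecord F N) (p : B12.RunParams) (k : ℕ) [DecidableEq (PBond (F.P p.K) (k + 1))] :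
    ROp03IntOfRecord F N rep p k = ropTotalBy ProvisoForm.int (rep p k) :=
  ropTotalBy_int_instIrrel _ _ (rep p k)

/-- **(0.4) for v1.4, every run, step and density** (`Residual₅.preservesIntegral_R` shape; guard unused). [cite: Balaban1989LargeFieldI, (0.4) p.176] -/
theorem preservesIntegral_ROp03IntOfRecord (rep : RepOfRecord F N) :
    ∀ (p : B12.RunParams) (k : ℕ), k < p.K → PreservesIntegral (ROp03IntOfRecord F N rep p k) :=
  preservesIntegral_ROp03ByOfRecord F N _ rep

/-- (0.4) for v1.4 without the guard. [cite: Balaban1989LargeFieldI, (0.4) p.176] -/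
theorem preservesIntegral_ROp03IntOfRecord' (rep : RepOfRecord F N) (p : B12.RunParams) (k : ℕ) :
    PreservesIntegral (ROp03IntOfRecord F N rep p k) :=
  preservesIntegral_ROp03ByOfRecord' F N _ rep p k

/-- **Integrability is preserved by v1.4** (`Residual₅.integrable_R` shape). [cite: Balaban1989LargeFieldI, (0.3)–(0.4) p.176 (bookkeeping)] -/
theorem integrable_ROp03IntOfRecord (rep : RepOfRecord F N) :
    ∀ (p : B12.RunParams) (k : ℕ), k < p.K → ∀ ρ : Density (F.P p.K) (k + 1) (SU N),
      Integrable ρ (fieldMeasure (F.P p.K) (k + 1) (SU N)) →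
        Integrable (ROp03IntOfRecord F N rep p k ρ) (fieldMeasure (F.P p.K) (k + 1) (SU N)) :=
  integrable_ROp03ByOfRecord F N _ rep

/-- v1.4 on its admissible branch, at the consumer's instance. [cite: Balaban1989LargeFieldI, (0.3) p.176 (bookkeeping)] -/
theorem ROp03IntOfRecord_of_admissibleBy {rep : RepOfRecord F N} {p : B12.RunParams} {k : ℕ} [DecidableEq (PBond (F.P p.K) (k + 1))]
    {ρ : Density (F.P p.K) (k + 1) (SU N)} (h : AdmissibleBy ProvisoForm.int (rep p k) ρ) :
    ROp03IntOfRecord F N rep p k ρ = (rep p k ρ).rop := by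
  rw [ROp03IntOfRecord_eq_ropTotalBy]
  exact ropTotalBy_of_admissible h

/-- v1.4 off its admissible branch, at the consumer's instance. [cite: Balaban1989LargeFieldI, (0.3) p.176 (typing convention)] -/
theorem ROp03IntOfRecord_of_not {rep : RepOfRecord F N} {p : B12.RunParams} {k : ℕ} [DecidableEq (PBond (F.P p.K) (k + 1))]
    {ρ : Density (F.P p.K) (k + 1) (SU N)} (h : ¬ AdmissibleBy ProvisoForm.int (rep p k) ρ) :
    ROp03IntOfRecord F N rep p k ρ = ρ := by
  rw [ROp03IntOfRecord_eq_ropTotalBy]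
  exact ropTotalBy_of_not h

/-- **v1.4 preserves a.e. non-negativity** (every run and step, consumer's instance). [cite: Balaban1989LargeFieldI, (0.3) p.176 («the densities are positive», weak form)] -/
theorem ROp03IntOfRecord_nonneg_ae (rep : RepOfRecord F N) (p : B12.RunParams) (k : ℕ) [DecidableEq (PBond (F.P p.K) (k + 1))]
    {ρ : Density (F.P p.K) (k + 1) (SU N)} (hρ : ∀ᵐ V ∂(fieldMeasure (F.P p.K) (k + 1) (SU N)), 0 ≤ ρ V) :
    ∀ᵐ V ∂(fieldMeasure (F.P p.K) (k + 1) (SU N)), 0 ≤ ROp03IntOfRecord F N rep p k ρ V := by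
  rw [ROp03IntOfRecord_eq_ropTotalBy]
  exact ropTotalBy_int_nonneg_ae (rep p k) hρ

end Pin

/-! ## §4  GENERIC (2.18) FACES: the integrable provisos of `repDataOfSel r sel fib` on the summands `t_a = χ(a)·(𝐓e^{A})(a)` -/

section Generic218

variable {P : Params} {j : ℕ} {G : Type*} [GaugeGroup G] [MeasurableSpace G] [HaarData G] [DecidableEq (PBond P j)]

/-- The INTEGRABLE provisos of the R-step datum of a (2.18) representation, written out on the summands `t_a` (`Iff.rfl`).
[cite: Balaban1989LargeFieldI, (0.3) p.176; Balaban1988Convergent, (2.18) p.257] -/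
theorem provisosInt_repDataOfSel_iff (r : Step.Repr218 P G j) (sel : r.Adm → r.Adm) (fib : r.Adm → Finset (PBond P j)) :
    (repDataOfSel r sel fib).ProvisosInt ↔
      (∀ a, Integrable (rterm r a) (fieldMeasure P j G)) ∧ (∀ a, ∀ᵐ V ∂(fieldMeasure P j G), 0 ≤ rterm r a V) ∧
        ∀ a, ∀ᵐ V ∂(fieldMeasure P j G), fibreIntegral (fib a) (rterm r (sel a)) V = 0 → rterm r a V = 0 :=
  Iff.rfl

/-- **SUFFICIENT CONDITIONS ON THE FACTORS**: `χ(a)` a.e.-strongly measurable with `0 ≤ χ(a) ≤ 1` (pointwise — products of characteristic functions), the slot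
INTEGRABLE and `≥ 0` a.e., and the support clause on the factors a.e. give the integrable provisos of the R-step datum.
[cite: Balaban1989LargeFieldI, (0.3) p.176; Balaban1988Convergent, (2.17)–(2.18) p.257] -/
theorem provisosInt_repDataOfSel_of_factors (r : Step.Repr218 P G j) (sel : r.Adm → r.Adm) (fib : r.Adm → Finset (PBond P j))
    (hχm : ∀ a, AEStronglyMeasurable (r.χ a) (fieldMeasure P j G)) (hχ0 : ∀ a V, 0 ≤ r.χ a V) (hχ1 : ∀ a V, r.χ a V ≤ 1)
    (hTi : ∀ a, Integrable (r.TexpA a) (fieldMeasure P j G)) (hT0 : ∀ a, ∀ᵐ V ∂(fieldMeasure P j G), 0 ≤ r.TexpA a V)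
    (hsupp : ∀ a, ∀ᵐ V ∂(fieldMeasure P j G),
      fibreIntegral (fib a) (rterm r (sel a)) V = 0 → r.χ a V = 0 ∨ r.TexpA a V = 0) :
    (repDataOfSel r sel fib).ProvisosInt := by
  refine ⟨fun a => ?_, fun a => ?_, fun a => ?_⟩
  · exact (hTi a).bdd_mul (hχm a) (ae_of_all _ fun V => by
      rw [Real.norm_eq_abs, abs_of_nonneg (hχ0 a V)]; exact hχ1 a V)
  · filter_upwards [hT0 a] with V hV
    exact mul_nonneg (hχ0 a V) hV
  · filter_upwards [hsupp a] with V hV h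
    show r.χ a V * r.TexpA a V = 0
    rcases hV h with h0 | h0
    · rw [h0, zero_mul]
    · rw [h0, mul_zero]

/-- **AT THE IDENTITY SELECTOR `a ↦ a` NOTHING BUT INTEGRABILITY AND SIGNS**: `χ(a)` a.e.-strongly measurable with `0 ≤ χ(a) ≤ 1`, the slots INTEGRABLE and `≥ 0`
a.e. give the integrable provisos of the R-step datum — the support conjunct is `suppClause_self_ae`.
[cite: Balaban1989LargeFieldI, (0.3) p.176; Balaban1988Convergent, (2.17)–(2.18) p.257] -/
theorem provisosInt_repDataOfSel_of_sel_id (r : Step.Repr218 P G j) (sel : r.Adm → r.Adm) (fib : r.Adm → Finset (PBond P j))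
    (hsel : ∀ a, sel a = a)
    (hχm : ∀ a, AEStronglyMeasurable (r.χ a) (fieldMeasure P j G)) (hχ0 : ∀ a V, 0 ≤ r.χ a V) (hχ1 : ∀ a V, r.χ a V ≤ 1)
    (hTi : ∀ a, Integrable (r.TexpA a) (fieldMeasure P j G)) (hT0 : ∀ a, ∀ᵐ V ∂(fieldMeasure P j G), 0 ≤ r.TexpA a V) :
    (repDataOfSel r sel fib).ProvisosInt := by
  have hint : ∀ a, Integrable (rterm r a) (fieldMeasure P j G) := fun a =>
    (hTi a).bdd_mul (hχm a) (ae_of_all _ fun V => by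
      rw [Real.norm_eq_abs, abs_of_nonneg (hχ0 a V)]; exact hχ1 a V)
  have h0 : ∀ a, ∀ᵐ V ∂(fieldMeasure P j G), 0 ≤ rterm r a V := fun a => by
    filter_upwards [hT0 a] with V hV
    exact mul_nonneg (hχ0 a V) hV
  refine ⟨hint, h0, fun a => ?_⟩
  show ∀ᵐ V ∂(fieldMeasure P j G), fibreIntegral (fib a) (rterm r (sel a)) V = 0 → rterm r a V = 0
  rw [hsel a]
  exact suppClause_self_ae (fib a) (hint a) (h0 a)

/-- **AT A SELECTOR THAT MOVES ONLY DEAD SUMMANDS, NOTHING BUT INTEGRABILITY AND SIGNS**: if every `a` is a fixed point of `sel` or DEAD (at every `V`, the slot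
`(𝐓e^{A})(a)(V) = 0` or `∫dV⌈_{Z′(a)} t_a = 0 at V`), then `χ(a)` a.e.-strongly measurable with `0 ≤ χ(a) ≤ 1` and the slots INTEGRABLE and `≥ 0` a.e. give the
integrable provisos of the R-step datum: at a fixed point the support conjunct is `suppClause_self_ae`; a dead summand vanishes a.e.
(`ae_eq_zero_of_self_or_fibreIntegral_eq_zero`), so its conjunct is trivial.  A selector that is the identity on the LIVE sequences (`∃ V, slot ≠ 0 ∧ ∫⌈ t ≠ 0`)
and collapses the others onto live ones is of this kind. [cite: Balaban1989LargeFieldI, (0.3) p.176; Balaban1988Convergent, (2.17)–(2.18) p.257] -/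
theorem provisosInt_repDataOfSel_of_sel_fixed_or_null (r : Step.Repr218 P G j) (sel : r.Adm → r.Adm) (fib : r.Adm → Finset (PBond P j))
    (hsel : ∀ a, sel a = a ∨ ∀ V, r.TexpA a V = 0 ∨ fibreIntegral (fib a) (rterm r a) V = 0)
    (hχm : ∀ a, AEStronglyMeasurable (r.χ a) (fieldMeasure P j G)) (hχ0 : ∀ a V, 0 ≤ r.χ a V) (hχ1 : ∀ a V, r.χ a V ≤ 1)
    (hTi : ∀ a, Integrable (r.TexpA a) (fieldMeasure P j G)) (hT0 : ∀ a, ∀ᵐ V ∂(fieldMeasure P j G), 0 ≤ r.TexpA a V) :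
    (repDataOfSel r sel fib).ProvisosInt := by
  have hint : ∀ a, Integrable (rterm r a) (fieldMeasure P j G) := fun a =>
    (hTi a).bdd_mul (hχm a) (ae_of_all _ fun V => by
      rw [Real.norm_eq_abs, abs_of_nonneg (hχ0 a V)]; exact hχ1 a V)
  have h0 : ∀ a, ∀ᵐ V ∂(fieldMeasure P j G), 0 ≤ rterm r a V := fun a => by
    filter_upwards [hT0 a] with V hV
    exact mul_nonneg (hχ0 a V) hV
  refine ⟨hint, h0, fun a => ?_⟩
  show ∀ᵐ V ∂(fieldMeasure P j G), fibreIntegral (fib a) (rterm r (sel a)) V = 0 → rterm r a V = 0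
  rcases hsel a with ha | ha
  · rw [ha]
    exact suppClause_self_ae (fib a) (hint a) (h0 a)
  · have hdead : ∀ V, rterm r a V = 0 ∨ fibreIntegral (fib a) (rterm r a) V = 0 := fun V =>
      (ha V).imp_left fun h => show r.χ a V * r.TexpA a V = 0 by rw [h, mul_zero]
    filter_upwards [ae_eq_zero_of_self_or_fibreIntegral_eq_zero (fib a) (hint a) (h0 a) hdead] with V hV
    exact fun _ => hV

end Generic218

/-! ## §5  TOWER-OF-RECORD FACES (consumer's instance): the integrable provisos of the tower's R-step data, (0.4) and integrability at a slot family under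
them, and v1.4 at the tower -/

section Record

variable (F : T4Family) (N : ℕ) [NeZero N] (ν : Stage7Numerics) (τ : TowerNumerics)

/-- **THE INTEGRABLE (0.3) PROVISOS OF THE TOWER OF RECORD, WRITTEN OUT** on the slot family `texpA` (consumer's instance): the summands `χ_k(s)·slot(s)`
INTEGRABLE, `≥ 0` a.e., and the support clause a.e. — NO uniform bound.  `Iff.rfl`. [cite: Balaban1989LargeFieldI, (0.3) p.176] -/
theorem provisosInt_towerRepOfRecord_iff (texpA : TexpAOfRecord F N ν τ.M) (ppSel : PpSelOfRecord F ν τ.M)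
    (p : B12.RunParams) (g : ℕ → ℝ) (k : ℕ) [DecidableEq (PBond (F.P p.K) k)] :
    (towerRepOfRecord F N ν τ texpA ppSel p g k).toRepData.ProvisosInt ↔
      (∀ s, Integrable (fun V => chiSeqOfRecord F N ν τ.M g p.K k s V * texpA p g k s V) (fieldMeasure (F.P p.K) k (SU N))) ∧
      (∀ s, ∀ᵐ V ∂(fieldMeasure (F.P p.K) k (SU N)), 0 ≤ chiSeqOfRecord F N ν τ.M g p.K k s V * texpA p g k s V) ∧
      ∀ s, ∀ᵐ V ∂(fieldMeasure (F.P p.K) k (SU N)), fibreIntegral (fibOfSeq F ν τ p g k s)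
          (fun V => chiSeqOfRecord F N ν τ.M g p.K k (ppSel p g k s) V * texpA p g k (ppSel p g k s) V) V = 0 →
        chiSeqOfRecord F N ν τ.M g p.K k s V * texpA p g k s V = 0 :=
  Iff.rfl

/-- n10-b's support-form provisos of the tower of record (as keyed in `Provisos₁₀.rstep`) imply the integrable ones: re-keying the row to the integrable form
loses nothing. [cite: Balaban1989LargeFieldI, (0.3) p.176 (bookkeeping)] -/
theorem provisosInt_towerRepOfRecord_of_provisosSupp (texpA : TexpAOfRecord F N ν τ.M) (ppSel : PpSelOfRecord F ν τ.M)
    (p : B12.RunParams) (g : ℕ → ℝ) (k : ℕ) [DecidableEq (PBond (F.P p.K) k)]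
    (h : (towerRepOfRecord F N ν τ texpA ppSel p g k).toRepData.ProvisosSupp) :
    (towerRepOfRecord F N ν τ texpA ppSel p g k).toRepData.ProvisosInt :=
  RepData.provisosInt_of_provisosSupp _ h

/-- FILE 12's essential provisos of the tower of record imply the integrable ones. [cite: Balaban1989LargeFieldI, (0.3) p.176 (bookkeeping)] -/
theorem provisosInt_towerRepOfRecord_of_provisosEss (texpA : TexpAOfRecord F N ν τ.M) (ppSel : PpSelOfRecord F ν τ.M)
    (p : B12.RunParams) (g : ℕ → ℝ) (k : ℕ) [DecidableEq (PBond (F.P p.K) k)]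
    (h : (towerRepOfRecord F N ν τ texpA ppSel p g k).toRepData.ProvisosEss) :
    (towerRepOfRecord F N ν τ texpA ppSel p g k).toRepData.ProvisosInt :=
  RepData.provisosInt_of_provisosEss _ h

/-- **THE INTEGRABLE PROVISOS OF THE TOWER OF RECORD FROM DISPLAYED SLOT PROPERTIES**: `χ_k(s)` of record a.e.-strongly measurable, the slots INTEGRABLE and `≥ 0`
a.e., and the support clause on the factors a.e. (`0 ≤ χ_k(s) ≤ 1` everywhere is FILE 10's `chiSeqOfRecord_nonneg` ∕ `_le_one`).
[cite: Balaban1989LargeFieldI, (0.3) p.176; Balaban1988Convergent, (2.17)–(2.18) p.257] -/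
theorem provisosInt_towerRepOfRecord_of_slots (texpA : TexpAOfRecord F N ν τ.M) (ppSel : PpSelOfRecord F ν τ.M)
    (p : B12.RunParams) (g : ℕ → ℝ) (k : ℕ) [DecidableEq (PBond (F.P p.K) k)]
    (hχm : ∀ s, AEStronglyMeasurable (chiSeqOfRecord F N ν τ.M g p.K k s) (fieldMeasure (F.P p.K) k (SU N)))
    (hTi : ∀ s, Integrable (texpA p g k s) (fieldMeasure (F.P p.K) k (SU N)))
    (hT0 : ∀ s, ∀ᵐ V ∂(fieldMeasure (F.P p.K) k (SU N)), 0 ≤ texpA p g k s V)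
    (hsupp : ∀ s, ∀ᵐ V ∂(fieldMeasure (F.P p.K) k (SU N)), fibreIntegral (fibOfSeq F ν τ p g k s)
        (fun V => chiSeqOfRecord F N ν τ.M g p.K k (ppSel p g k s) V * texpA p g k (ppSel p g k s) V) V = 0 →
      chiSeqOfRecord F N ν τ.M g p.K k s V = 0 ∨ texpA p g k s V = 0) :
    (towerRepOfRecord F N ν τ texpA ppSel p g k).toRepData.ProvisosInt :=
  provisosInt_repDataOfSel_of_factors (repr218OfRecord F N ν τ.M texpA p g k) (ppSel p g k) (fibOfSeq F ν τ p g k) hχm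
    (fun s V => chiSeqOfRecord_nonneg F N ν τ.M g p.K k s V) (fun s V => chiSeqOfRecord_le_one F N ν τ.M g p.K k s V) hTi hT0 hsupp

/-- **THE INTEGRABLE PROVISOS OF THE TOWER OF RECORD AT AN IDENTITY SELECTOR, FROM INTEGRABILITY AND SIGNS ALONE**: if `ppSel p g k` is the identity on
sequences, then `χ_k(s)` of record a.e.-strongly measurable and the slots INTEGRABLE and `≥ 0` a.e. suffice — NO bound, NO support hypothesis (it is
`suppClause_self_ae`).  Consumers at the selector of record `ppSelIdOfRecord` pass `fun _ => rfl`. [cite: Balaban1989LargeFieldI, (0.3) p.176; Balaban1988Convergent, (2.17)–(2.18) p.257] -/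
theorem provisosInt_towerRepOfRecord_of_sel_id (texpA : TexpAOfRecord F N ν τ.M) (ppSel : PpSelOfRecord F ν τ.M)
    (p : B12.RunParams) (g : ℕ → ℝ) (k : ℕ) [DecidableEq (PBond (F.P p.K) k)] (hsel : ∀ s, ppSel p g k s = s)
    (hχm : ∀ s, AEStronglyMeasurable (chiSeqOfRecord F N ν τ.M g p.K k s) (fieldMeasure (F.P p.K) k (SU N)))
    (hTi : ∀ s, Integrable (texpA p g k s) (fieldMeasure (F.P p.K) k (SU N)))
    (hT0 : ∀ s, ∀ᵐ V ∂(fieldMeasure (F.P p.K) k (SU N)), 0 ≤ texpA p g k s V) :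
    (towerRepOfRecord F N ν τ texpA ppSel p g k).toRepData.ProvisosInt :=
  provisosInt_repDataOfSel_of_sel_id (repr218OfRecord F N ν τ.M texpA p g k) (ppSel p g k) (fibOfSeq F ν τ p g k) hsel hχm
    (fun s V => chiSeqOfRecord_nonneg F N ν τ.M g p.K k s V) (fun s V => chiSeqOfRecord_le_one F N ν τ.M g p.K k s V) hTi hT0

/-- **THE INTEGRABLE PROVISOS OF THE TOWER OF RECORD AT A SELECTOR THAT MOVES ONLY DEAD SEQUENCES, FROM INTEGRABILITY AND SIGNS ALONE**: if every sequence
`s` is a fixed point of `ppSel p g k` or DEAD (at every `V`, `slot(s)(V) = 0` or `∫dV⌈_{Z′(s)} χ_k(s)·slot(s) = 0 at V`), then `χ_k(s)` of record a.e.-strongly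
measurable and the slots INTEGRABLE and `≥ 0` a.e. suffice — NO bound, NO support hypothesis.  The selector of the K0′ witness after director's LINE №114 (α)
(identity on the live sequences, the rest collapsed onto live ones) is of this kind; the identity selector is the case «every `s` fixed».
[cite: Balaban1989LargeFieldI, (0.3) p.176; Balaban1988Convergent, (2.17)–(2.18) p.257] -/
theorem provisosInt_towerRepOfRecord_of_sel_fixed_or_null (texpA : TexpAOfRecord F N ν τ.M) (ppSel : PpSelOfRecord F ν τ.M)
    (p : B12.RunParams) (g : ℕ → ℝ) (k : ℕ) [DecidableEq (PBond (F.P p.K) k)]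
    (hsel : ∀ s, ppSel p g k s = s ∨ ∀ V, texpA p g k s V = 0 ∨
      fibreIntegral (fibOfSeq F ν τ p g k s) (fun V => chiSeqOfRecord F N ν τ.M g p.K k s V * texpA p g k s V) V = 0)
    (hχm : ∀ s, AEStronglyMeasurable (chiSeqOfRecord F N ν τ.M g p.K k s) (fieldMeasure (F.P p.K) k (SU N)))
    (hTi : ∀ s, Integrable (texpA p g k s) (fieldMeasure (F.P p.K) k (SU N)))
    (hT0 : ∀ s, ∀ᵐ V ∂(fieldMeasure (F.P p.K) k (SU N)), 0 ≤ texpA p g k s V) :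
    (towerRepOfRecord F N ν τ texpA ppSel p g k).toRepData.ProvisosInt :=
  provisosInt_repDataOfSel_of_sel_fixed_or_null (repr218OfRecord F N ν τ.M texpA p g k) (ppSel p g k) (fibOfSeq F ν τ p g k) hsel
    hχm (fun s V => chiSeqOfRecord_nonneg F N ν τ.M g p.K k s V) (fun s V => chiSeqOfRecord_le_one F N ν τ.M g p.K k s V) hTi hT0

/-- **ZERO SLOT FAMILY: the integrable provisos of the tower of record HOLD** (junk inhabitant, through FILE 10's support-form one; plan's K0 direction).
[cite: Balaban1989LargeFieldI, (0.3) p.176 (bookkeeping)] -/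
theorem provisosInt_towerRepOfRecord_of_slot_eq_zero (texpA : TexpAOfRecord F N ν τ.M) (ppSel : PpSelOfRecord F ν τ.M)
    (p : B12.RunParams) (g : ℕ → ℝ) (k : ℕ) [DecidableEq (PBond (F.P p.K) k)] (h0 : ∀ s V, texpA p g k s V = 0) :
    (towerRepOfRecord F N ν τ texpA ppSel p g k).toRepData.ProvisosInt :=
  provisosInt_towerRepOfRecord_of_provisosSupp F N ν τ texpA ppSel p g k
    (provisosSupp_towerRepOfRecord_of_slot_eq_zero F N ν τ texpA ppSel p g k h0)

/-- **(0.4) AT A SLOT FAMILY UNDER THE INTEGRABLE FORM**: under `ProvisosInt` of the tower of record at level `k`, the slice density of the R-stepped slot and the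
represented density of the slot have equal integrals (`integral_rop_eq_of_provisosInt` at the tower datum, whose (0.3) is the slice density of the R-stepped slot
(FILE 8) and whose total is the represented density (FILE 5, `rfl`)). [cite: Balaban1989LargeFieldI, (0.4) p.176] -/
theorem integral_densityOfSlice_rstepSlotOfRecord_of_provisosInt (texpA : TexpAOfRecord F N ν τ.M) (ppSel : PpSelOfRecord F ν τ.M)
    (p : B12.RunParams) (g : ℕ → ℝ) (k : ℕ) [DecidableEq (PBond (F.P p.K) k)]
    (hprov : (towerRepOfRecord F N ν τ texpA ppSel p g k).toRepData.ProvisosInt) :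
    ∫ V, densityOfSlice F N ν τ.M p g k (rstepSlotOfRecord F N ν τ ppSel p g k (texpA p g k)) V ∂(fieldMeasure (F.P p.K) k (SU N))
      = ∫ V, densityOfRepr F N ν τ.M texpA p g k V ∂(fieldMeasure (F.P p.K) k (SU N)) := by
  rw [← rop_towerRepOfRecord_eq_densityOfSlice' F N ν τ texpA ppSel p g k]
  have h := (towerRepOfRecord F N ν τ texpA ppSel p g k).toRepData.integral_rop_eq_of_provisosInt hprov
  rw [TowerRep.toRepData_total, towerRepOfRecord_total] at h
  exact h

/-- **INTEGRABILITY AT A SLOT FAMILY UNDER THE INTEGRABLE FORM**: under `ProvisosInt` of the tower of record at level `k`, the slice density of the R-stepped slot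
is integrable (consumer's instance). [cite: Balaban1989LargeFieldI, (0.3)–(0.4) p.176] -/
theorem integrable_densityOfSlice_rstepSlotOfRecord_of_provisosInt (texpA : TexpAOfRecord F N ν τ.M) (ppSel : PpSelOfRecord F ν τ.M)
    (p : B12.RunParams) (g : ℕ → ℝ) (k : ℕ) [DecidableEq (PBond (F.P p.K) k)]
    (hprov : (towerRepOfRecord F N ν τ texpA ppSel p g k).toRepData.ProvisosInt) :
    Integrable (densityOfSlice F N ν τ.M p g k (rstepSlotOfRecord F N ν τ ppSel p g k (texpA p g k))) (fieldMeasure (F.P p.K) k (SU N)) := by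
  rw [← rop_towerRepOfRecord_eq_densityOfSlice' F N ν τ texpA ppSel p g k]
  exact RepData.integrable_rop_of_provisosInt _ hprov

/-- **(0.4) AT A SLOT FAMILY AT AN IDENTITY SELECTOR, FROM INTEGRABILITY AND SIGNS ALONE** (composite of `…_of_sel_id` and the previous face).
[cite: Balaban1989LargeFieldI, (0.4) p.176] -/
theorem integral_densityOfSlice_rstepSlotOfRecord_of_sel_id (texpA : TexpAOfRecord F N ν τ.M) (ppSel : PpSelOfRecord F ν τ.M)
    (p : B12.RunParams) (g : ℕ → ℝ) (k : ℕ) [DecidableEq (PBond (F.P p.K) k)] (hsel : ∀ s, ppSel p g k s = s)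
    (hχm : ∀ s, AEStronglyMeasurable (chiSeqOfRecord F N ν τ.M g p.K k s) (fieldMeasure (F.P p.K) k (SU N)))
    (hTi : ∀ s, Integrable (texpA p g k s) (fieldMeasure (F.P p.K) k (SU N)))
    (hT0 : ∀ s, ∀ᵐ V ∂(fieldMeasure (F.P p.K) k (SU N)), 0 ≤ texpA p g k s V) :
    ∫ V, densityOfSlice F N ν τ.M p g k (rstepSlotOfRecord F N ν τ ppSel p g k (texpA p g k)) V ∂(fieldMeasure (F.P p.K) k (SU N))
      = ∫ V, densityOfRepr F N ν τ.M texpA p g k V ∂(fieldMeasure (F.P p.K) k (SU N)) :=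
  integral_densityOfSlice_rstepSlotOfRecord_of_provisosInt F N ν τ texpA ppSel p g k
    (provisosInt_towerRepOfRecord_of_sel_id F N ν τ texpA ppSel p g k hsel hχm hTi hT0)

variable {ν τ}

/-- **v1.4 at a tower carried as `RepData`**: on a density a.e.-equal to the tower's total, under `ProvisosInt` (consumer's instance), `R` of record over the
integrable form IS the explicit (0.3) of the tower. [cite: Balaban1989LargeFieldI, (0.3) p.176] -/
theorem ROp03IntOfRecord_repOfDataAE_of_ae (T : RepDataTower F N) {p : B12.RunParams} {k : ℕ} [DecidableEq (PBond (F.P p.K) (k + 1))]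
    {ρ : Density (F.P p.K) (k + 1) (SU N)} (hae : (T p k).total =ᵐ[fieldMeasure (F.P p.K) (k + 1) (SU N)] ρ)
    (hprov : (T p k).ProvisosInt) : ROp03IntOfRecord F N (repOfDataAE F N T) p k ρ = (T p k).rop :=
  (ROp03ByOfRecord_repOfDataAE_of_ae F N (ProvisoFormOfRecord.int F N) T hae ((provisosInt_instIrrel _ _ _).1 hprov)).trans
    (rop_instIrrel _ _ _)

variable (ν τ)

/-- **v1.4 at the tower OF RECORD**: on a density a.e.-equal to the record's represented density after `k + 1` steps, under `ProvisosInt` of the tower datum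
(consumer's instance), `R` of record over the integrable form IS the explicit (0.3) of the tower of record. [cite: Balaban1989LargeFieldI, (0.3)–(0.4) p.176] -/
theorem ROp03IntOfRecord_repOfRecordAE_of_ae (texpA : TexpAOfRecord F N ν τ.M) (ppSel : PpSelOfRecord F ν τ.M)
    (gsel : B12.RunParams → ℕ → ℝ) (p : B12.RunParams) (k : ℕ) [DecidableEq (PBond (F.P p.K) (k + 1))]
    {ρ : Density (F.P p.K) (k + 1) (SU N)}
    (hae : (towerOfRecord F N ν τ texpA ppSel gsel p k).toRepData.total =ᵐ[fieldMeasure (F.P p.K) (k + 1) (SU N)] ρ)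
    (hprov : (towerOfRecord F N ν τ texpA ppSel gsel p k).toRepData.ProvisosInt) :
    ROp03IntOfRecord F N (repOfRecordAE F N ν τ texpA ppSel gsel) p k ρ
      = (towerOfRecord F N ν τ texpA ppSel gsel p k).toRepData.rop :=
  ROp03IntOfRecord_repOfDataAE_of_ae F N (fun p k => (towerOfRecord F N ν τ texpA ppSel gsel p k).toRepData) hae hprov

/-- **v1.4 maps the represented density of a slot family to the slice density of its R-stepped slot** (under the a.e. identity and the INTEGRABLE provisos of
the tower datum, consumer's instance). [cite: Balaban1989LargeFieldI, (0.3)–(0.4) p.176; Balaban1988Convergent, Theorem 1 p.262] -/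
theorem ROp03IntOfRecord_repOfRecordAE_eq_densityOfSlice (texpA : TexpAOfRecord F N ν τ.M) (ppSel : PpSelOfRecord F ν τ.M)
    (gsel : B12.RunParams → ℕ → ℝ) (p : B12.RunParams) (k : ℕ) [DecidableEq (PBond (F.P p.K) (k + 1))]
    {ρ : Density (F.P p.K) (k + 1) (SU N)}
    (hae : (towerOfRecord F N ν τ texpA ppSel gsel p k).toRepData.total =ᵐ[fieldMeasure (F.P p.K) (k + 1) (SU N)] ρ)
    (hprov : (towerOfRecord F N ν τ texpA ppSel gsel p k).toRepData.ProvisosInt) :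
    ROp03IntOfRecord F N (repOfRecordAE F N ν τ texpA ppSel gsel) p k ρ
      = densityOfSlice F N ν τ.M p (gsel p) (k + 1)
          (rstepSlotOfRecord F N ν τ ppSel p (gsel p) (k + 1) (texpA p (gsel p) (k + 1))) :=
  (ROp03IntOfRecord_repOfRecordAE_of_ae F N ν τ texpA ppSel gsel p k hae hprov).trans
    (rop_towerRepOfRecord_eq_densityOfSlice' F N ν τ texpA ppSel p (gsel p) (k + 1))

/-- **(0.4) for v1.4 at the tower of record, in slot form**: under the a.e. identity alone, `∫ R ρ dV = ∫ (represented density) dV` (v1.4's (0.4) for every density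
composed with the a.e. identity; no proviso needed). [cite: Balaban1989LargeFieldI, (0.4) p.176] -/
theorem integral_ROp03IntOfRecord_repOfRecordAE (texpA : TexpAOfRecord F N ν τ.M) (ppSel : PpSelOfRecord F ν τ.M)
    (gsel : B12.RunParams → ℕ → ℝ) (p : B12.RunParams) (k : ℕ) {ρ : Density (F.P p.K) (k + 1) (SU N)}
    (hae : (towerOfRecord F N ν τ texpA ppSel gsel p k).toRepData.total =ᵐ[fieldMeasure (F.P p.K) (k + 1) (SU N)] ρ) :
    ∫ V, ROp03IntOfRecord F N (repOfRecordAE F N ν τ texpA ppSel gsel) p k ρ V ∂(fieldMeasure (F.P p.K) (k + 1) (SU N))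
      = ∫ V, densityOfRepr F N ν τ.M texpA p (gsel p) (k + 1) V ∂(fieldMeasure (F.P p.K) (k + 1) (SU N)) := by
  rw [preservesIntegral_ROp03IntOfRecord' F N (repOfRecordAE F N ν τ texpA ppSel gsel) p k ρ]
  exact (integral_congr_ae hae).symm

end Record

/-! ## §6  ROW P6 IN THE INTEGRABLE FORM at a Stage-9 parameter: the displayed text, the keyed row implies it, and — at an identity selector — it HOLDS
under (H-U) and the ζ-laws alone -/

section Stage9

variable {F : T4Family} {N : ℕ} [NeZero N]

/-- **The 𝐓-slots of record are non-negative under the sign law `0 ≤ ζ`** (n23-b's `slotsTOfRecord_nonneg` at the weights of record `wOfRecord₉ θ`, whose sign is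
`wOfRecord_nonneg`), at every level and ANY selector. [cite: Balaban1988Convergent, (3.24)–(3.25) p.270 (bookkeeping)] -/
theorem Stage9Params.slotsTOfRecord_nonneg_of_zeta_nonneg (θ : Stage9Params F N)
    (hζ0 : ∀ p g k s Pl Ql RS U V', 0 ≤ θ.ζ p g k s Pl Ql RS U V') (p : B12.RunParams) (k : ℕ)
    (s : SeqOfRecord F θ.ν θ.τ9.M (gOfRecord₁₀ F N θ p) p.K k) (V : GaugeField (F.P p.K) k (SU N)) :
    0 ≤ slotsTOfRecord F N θ.ν θ.τ9 (EOfRecord₁₀ F N θ) (wOfRecord₉ F N θ) θ.ppSel p (gOfRecord₁₀ F N θ p) k s V :=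
  slotsTOfRecord_nonneg F N θ.ν θ.τ9 (EOfRecord₁₀ F N θ)
    (fun p' g' j s' U V' => wOfRecord_nonneg F N θ.ν θ.τ9.M p' g' j θ.A₁ hζ0 s' U V') θ.ppSel p (gOfRecord₁₀ F N θ p) k s V

/-- **THE 𝐓-SLOTS OF RECORD ARE INTEGRABLE AT EVERY POSITIVE LEVEL under (H-U) ∧ (H-ζ) ∧ the ζ-size law ∧ `0 ≤ ζ`, AT ANY SELECTOR** (K0c FILE 2
`piece_slotsOfRecord_measurable_integrable` at level `k`, then K0c FILE 1 `integrable_tstepOfRecord`).  Integrability is what the tree proves about the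
𝐓-slots; no uniform bound ((H-h) species) is claimed. [cite: Balaban1988Convergent, (3.24)–(3.25) p.270 (bookkeeping); Balaban1989LargeFieldI, (0.3) p.176 (bookkeeping)] -/
theorem Stage9Params.integrable_slotsTOfRecord_succ_of_localBg (θ : Stage9Params F N)
    (hU : LocalBgMeasurable F N θ.ν) (hζ : ZetaMeasurable F N θ.ζ) (hζa : IsZetaAbsLeOne F N θ.ν θ.τ9.M θ.ζ)
    (hζ0 : ∀ p g k s Pl Ql RS U V', 0 ≤ θ.ζ p g k s Pl Ql RS U V') (p : B12.RunParams) (k : ℕ) (hk : k < p.K)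
    (s' : SeqOfRecord F θ.ν θ.τ9.M (gOfRecord₁₀ F N θ p) p.K (k + 1)) :
    Integrable (slotsTOfRecord F N θ.ν θ.τ9 (EOfRecord₁₀ F N θ) (wOfRecord₉ F N θ) θ.ppSel p (gOfRecord₁₀ F N θ p) (k + 1) s')
      (fieldMeasure (F.P p.K) (k + 1) (SU N)) := by
  have hw : ∀ j, j < p.K → ∀ s', Measurable (fun z : GaugeField (F.P p.K) (j + 1) (SU N) × GaugeField (F.P p.K) j (SU N) =>
      wOfRecord₉ F N θ p (gOfRecord₁₀ F N θ p) j s' z.2 z.1) :=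
    fun j _ s' => measurable_wOfRecord_of_localBg hU θ.τ9.M θ.A₁ hζ p _ j s'
  have hwb : ∀ j, j < p.K → ∀ s' U V', |wOfRecord₉ F N θ p (gOfRecord₁₀ F N θ p) j s' U V'| ≤ 1 :=
    fun j _ s' U V' => abs_wOfRecord_le_one F N θ.ν θ.τ9.M θ.A₁ hζa p _ j s' U V'
  have hw0 : ∀ p' g' j s' U V', 0 ≤ wOfRecord₉ F N θ p' g' j s' U V' :=
    fun p' g' j s' U V' => wOfRecord_nonneg F N θ.ν θ.τ9.M p' g' j θ.A₁ hζ0 s' U V'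
  have hχ : ∀ j, j ≤ p.K → ∀ s, Measurable (chiSeqOfRecord F N θ.ν θ.τ9.M (gOfRecord₁₀ F N θ p) p.K j s) :=
    fun j _ s => measurable_chiSeqOfRecord_of_localBg hU θ.τ9.M _ p.K j s
  obtain ⟨-, hpiece⟩ := piece_slotsOfRecord_measurable_integrable F N θ.ν θ.τ9 (EOfRecord₁₀ F N θ) θ.ppSel hw hwb hw0 hχ k hk.le
  rw [slotsTOfRecord_succ]
  exact integrable_tstepOfRecord F N θ.ν θ.τ9.M hk (hw k hk) (hwb k hk) hpiece s'

/-- **ROW P6 IN THE INTEGRABLE FORM** (displayed text; the field a successor record would key in place of `Provisos₁₀.rstep`): for every run `p` and step `k < K`,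
the R-step datum of the tower of record at level `k + 1` — pieces `χ_{k+1}(s)·(𝐓ρ_k)(s)` along the generated histories `gOfRecord₁₀ θ p`, selector `θ.ppSel` —
satisfies `RepData.ProvisosInt`.  Verbatim `Provisos₁₀.rstep` with `.ProvisosSupp ↦ .ProvisosInt`; NO record is restated here.
[cite: Balaban1989LargeFieldI, (0.3)–(0.4) p.176; Balaban1988Convergent, (2.18) p.257] -/
def Stage9Params.RStepInt (θ : Stage9Params F N) : Prop :=
  ∀ (p : B12.RunParams) (k : ℕ) [DecidableEq (PBond (F.P p.K) (k + 1))], k < p.K →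
    (towerRepOfRecord F N θ.ν θ.τ9 (slotsTOfRecord F N θ.ν θ.τ9 (EOfRecord₁₀ F N θ) (wOfRecord₉ F N θ) θ.ppSel) θ.ppSel p
      (gOfRecord₁₀ F N θ p) (k + 1)).toRepData.ProvisosInt

/-- **THE KEYED ROW IMPLIES THE INTEGRABLE ROW** (`Provisos₁₀.rstep`'s text, as a hypothesis ⇒ `RStepInt`): re-keying row P6 to the integrable form loses nothing
downstream. [cite: Balaban1989LargeFieldI, (0.3) p.176 (bookkeeping)] -/
theorem Stage9Params.rstepInt_of_rstep (θ : Stage9Params F N)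
    (h : ∀ (p : B12.RunParams) (k : ℕ) [DecidableEq (PBond (F.P p.K) (k + 1))], k < p.K →
      (towerRepOfRecord F N θ.ν θ.τ9 (slotsTOfRecord F N θ.ν θ.τ9 (EOfRecord₁₀ F N θ) (wOfRecord₉ F N θ) θ.ppSel) θ.ppSel p
        (gOfRecord₁₀ F N θ p) (k + 1)).toRepData.ProvisosSupp) : θ.RStepInt :=
  fun p k _ hk => provisosInt_towerRepOfRecord_of_provisosSupp F N θ.ν θ.τ9 _ θ.ppSel p _ (k + 1) (h p k hk)

/-- A Stage-10 provisos record (def-T's `Provisos₁₀`, row P6 keyed in support form) yields the integrable row. [cite: Balaban1989LargeFieldI, (0.3) p.176 (bookkeeping)] -/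
theorem Stage9Params.rstepInt_of_provisos₁₀ (θ : Stage9Params F N) (h : θ.Provisos₁₀) : θ.RStepInt :=
  θ.rstepInt_of_rstep fun p k _ hk => h.rstep p k hk

/-- **ROW P6 IN THE INTEGRABLE FORM HOLDS UNDER (H-U) ∧ (H-ζ) ∧ THE ζ-SIZE LAW ∧ `0 ≤ ζ` AT EVERY SELECTOR THAT MOVES ONLY DEAD SEQUENCES** — no bound on the
marginal density of the averaging transport ((H-h)), no support hypothesis ((H-supp)): if at every positive level every sequence `s` is a fixed point of
`θ.ppSel` or DEAD (at every `V`, `(𝐓ρ_k)(s)(V) = 0` or `∫dV⌈_{Z′(s)} χ_{k+1}(s)·(𝐓ρ_k)(s) = 0 at V`), then `θ.RStepInt`: the pieces are integrable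
(`integrable_slotsTOfRecord_succ_of_localBg`, `|χ| ≤ 1`), non-negative (`slotsTOfRecord_nonneg_of_zeta_nonneg`), and the support conjunct is §1's
`suppClause_self_ae` at fixed points and trivial at dead sequences.  The selector of the K0′ witness after director's LINE №114 (α) — identity on the LIVE
sequences, the others collapsed onto live ones — is of this kind. [cite: Balaban1989LargeFieldI, (0.3)–(0.4) p.176; Balaban1988Convergent, (2.17)–(2.18) p.257, (3.24)–(3.25) p.270 (bookkeeping)] -/
theorem Stage9Params.rstepInt_of_localBg_of_sel (θ : Stage9Params F N)
    (hU : LocalBgMeasurable F N θ.ν) (hζ : ZetaMeasurable F N θ.ζ) (hζa : IsZetaAbsLeOne F N θ.ν θ.τ9.M θ.ζ)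
    (hζ0 : ∀ p g k s Pl Ql RS U V', 0 ≤ θ.ζ p g k s Pl Ql RS U V')
    (hsel : ∀ (p : B12.RunParams) (k : ℕ) [DecidableEq (PBond (F.P p.K) (k + 1))], k < p.K →
      ∀ s, θ.ppSel p (gOfRecord₁₀ F N θ p) (k + 1) s = s ∨
        ∀ V, slotsTOfRecord F N θ.ν θ.τ9 (EOfRecord₁₀ F N θ) (wOfRecord₉ F N θ) θ.ppSel p (gOfRecord₁₀ F N θ p) (k + 1) s V = 0 ∨
          fibreIntegral (fibOfSeq F θ.ν θ.τ9 p (gOfRecord₁₀ F N θ p) (k + 1) s)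
            (fun V => chiSeqOfRecord F N θ.ν θ.τ9.M (gOfRecord₁₀ F N θ p) p.K (k + 1) s V *
              slotsTOfRecord F N θ.ν θ.τ9 (EOfRecord₁₀ F N θ) (wOfRecord₉ F N θ) θ.ppSel p (gOfRecord₁₀ F N θ p) (k + 1) s V) V = 0) :
    θ.RStepInt := by
  intro p k _ hk
  exact provisosInt_towerRepOfRecord_of_sel_fixed_or_null F N θ.ν θ.τ9 _ θ.ppSel p _ (k + 1) (hsel p k hk)
    (fun s => (measurable_chiSeqOfRecord_of_localBg hU θ.τ9.M _ p.K (k + 1) s).aestronglyMeasurable)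
    (θ.integrable_slotsTOfRecord_succ_of_localBg hU hζ hζa hζ0 p k hk)
    (fun s => Filter.Eventually.of_forall (θ.slotsTOfRecord_nonneg_of_zeta_nonneg hζ0 p (k + 1) s))

/-- **ROW P6 IN THE INTEGRABLE FORM HOLDS AT AN IDENTITY SELECTOR UNDER (H-U) ∧ (H-ζ) ∧ THE ζ-SIZE LAW ∧ `0 ≤ ζ`** (every sequence fixed: the previous theorem)
— compare n23-b's `provisos₁₀_stage9DeltaOfRecord_of_regularity`, which needs (H-h) and (H-supp) for the keyed support form.
[cite: Balaban1989LargeFieldI, (0.3)–(0.4) p.176; Balaban1988Convergent, (2.17)–(2.18) p.257, (3.24)–(3.25) p.270 (bookkeeping)] -/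
theorem Stage9Params.rstepInt_of_localBg (θ : Stage9Params F N) (hsel : θ.ppSel = ppSelIdOfRecord F θ.ν θ.τ9.M)
    (hU : LocalBgMeasurable F N θ.ν) (hζ : ZetaMeasurable F N θ.ζ) (hζa : IsZetaAbsLeOne F N θ.ν θ.τ9.M θ.ζ)
    (hζ0 : ∀ p g k s Pl Ql RS U V', 0 ≤ θ.ζ p g k s Pl Ql RS U V') : θ.RStepInt :=
  θ.rstepInt_of_localBg_of_sel hU hζ hζa hζ0 fun p k _ _ s => Or.inl (by
    show θ.ppSel p _ (k + 1) s = ppSelIdOfRecord F θ.ν θ.τ9.M p (gOfRecord₁₀ F N θ p) (k + 1) s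
    rw [hsel])

/-- **ROW P6 IN THE INTEGRABLE FORM AT ANY SELECTOR, MODULO THE DISPLAYED A.E. SUPPORT CONJUNCT**: under (H-U) ∧ (H-ζ) ∧ the ζ-size law ∧ `0 ≤ ζ` the
integrability and sign conjuncts hold at every `θ : Stage9Params`; the support conjunct at a general `Z ↦ Z″` (print: «the integration domains … are
nonempty») is a HYPOTHESIS, displayed verbatim. [cite: Balaban1989LargeFieldI, (0.3)–(0.4) p.176; Balaban1988Convergent, (2.17)–(2.18) p.257, (3.24)–(3.25) p.270 (bookkeeping)] -/
theorem Stage9Params.rstepInt_of_localBg_anySel (θ : Stage9Params F N)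
    (hU : LocalBgMeasurable F N θ.ν) (hζ : ZetaMeasurable F N θ.ζ) (hζa : IsZetaAbsLeOne F N θ.ν θ.τ9.M θ.ζ)
    (hζ0 : ∀ p g k s Pl Ql RS U V', 0 ≤ θ.ζ p g k s Pl Ql RS U V')
    (hsupp : ∀ (p : B12.RunParams) (k : ℕ) [DecidableEq (PBond (F.P p.K) (k + 1))], k < p.K →
      ∀ s, ∀ᵐ V ∂(fieldMeasure (F.P p.K) (k + 1) (SU N)),
        fibreIntegral (fibOfSeq F θ.ν θ.τ9 p (gOfRecord₁₀ F N θ p) (k + 1) s)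
          (fun V => chiSeqOfRecord F N θ.ν θ.τ9.M (gOfRecord₁₀ F N θ p) p.K (k + 1) (θ.ppSel p (gOfRecord₁₀ F N θ p) (k + 1) s) V *
            slotsTOfRecord F N θ.ν θ.τ9 (EOfRecord₁₀ F N θ) (wOfRecord₉ F N θ) θ.ppSel p (gOfRecord₁₀ F N θ p) (k + 1)
              (θ.ppSel p (gOfRecord₁₀ F N θ p) (k + 1) s) V) V = 0 →
        chiSeqOfRecord F N θ.ν θ.τ9.M (gOfRecord₁₀ F N θ p) p.K (k + 1) s V *
          slotsTOfRecord F N θ.ν θ.τ9 (EOfRecord₁₀ F N θ) (wOfRecord₉ F N θ) θ.ppSel p (gOfRecord₁₀ F N θ p) (k + 1) s V = 0) :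
    θ.RStepInt := by
  intro p k _ hk
  refine (provisosInt_towerRepOfRecord_iff F N θ.ν θ.τ9 _ θ.ppSel p _ (k + 1)).2 ⟨fun s => ?_, fun s => ?_, hsupp p k hk⟩
  · exact (θ.integrable_slotsTOfRecord_succ_of_localBg hU hζ hζa hζ0 p k hk s).bdd_mul
      (measurable_chiSeqOfRecord_of_localBg hU θ.τ9.M _ p.K (k + 1) s).aestronglyMeasurable
      (ae_of_all _ fun U => by rw [Real.norm_eq_abs]; exact abs_chiSeqOfRecord_le_one F N θ.ν θ.τ9.M _ p.K (k + 1) s U)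
  · exact Filter.Eventually.of_forall fun V =>
      mul_nonneg (chiSeqOfRecord_nonneg F N θ.ν θ.τ9.M _ p.K (k + 1) s V) (θ.slotsTOfRecord_nonneg_of_zeta_nonneg hζ0 p (k + 1) s V)

end Stage9

end Literature.MathematicalPhysics.QuantumFieldTheory.Balaban1983to89.Node00

end
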